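import Literature.Analysis.FluidPDE.TaoAveragedEulerFormBound
import Literature.Analysis.FunctionSpaces.FourierSobolevNormEmbeddingProofs
import Mathlib.Analysis.Fourier.LpSpace
import Mathlib.Analysis.Calculus.LineDeriv.IntegrationByParts
import Mathlib.Analysis.Distribution.AEEqOfIntegralContDiff
import Mathlib.Analysis.Fourier.FourierTransformDeriv
import Mathlib.MeasureTheory.Integral.Prod
import Literature.Analysis.FluidPDE.TaoAveragedComplexAverageReal
import Literature.Analysis.FluidPDE.TaoAveragedFibreIdentity
import Literature.Analysis.FluidPDE.TaoAveragedSlotSobolev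
import Literature.Analysis.UnboundedOperators.HeatKernelGaussianData
import Literature.Analysis.FluidPDE.MildSolution
import Literature.Analysis.UnboundedOperators.HeatSemigroupLpProofs
import Literature.Analysis.UnboundedOperators.HeatKernelSymbol
import Literature.Analysis.FluidPDE.TaoCascadeProjection
import Literature.Analysis.FluidPDE.TaoAveragedEulerLerayL2
import Literature.Analysis.FluidPDE.NSCriticalClosureBesovKatoClass
import Literature.Analysis.FluidPDE.TaoCascadeDuhamel
import HarnessLib

/-!
# Tao's `H¹⁰_df` mild Navier–Stokes solutions, file 1 of 3: Fourier-side Sobolev calculus on `ℝ³`, the trilinear form and its cubic bound, the heat pairing, density, the tested Duhamel identity (re-homed proofs)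

**T. Tao, *Finite time blowup for an averaged three-dimensional Navier–Stokes equation*, J. Amer. Math. Soc. 29 (2016), §1.1
[Tao2016AveragedNS]: the `H¹⁰_df` mild formulation ((1.3)–(1.5), (1.15)) of the Navier–Stokes equation and its dictionary with
classical solutions.**  The named fact `Literature.Analysis.FluidPDE.FluidComputer.MildMaximalGivesBlowup`
(`FluidComputer/CascadeWitness.lean`: an `H¹⁰_df`-mild solution of the true equation from a Schwartz divergence-free datum on
`[0,S)` with no mild extension past `S` yields a maximal smooth solution with finite lifespan, Leray–Hopf from its rapidly
decaying datum) is PROVED in the tree by the Navier–Stokes perpetual-pump cell (a classical Tao-class solution is `H¹⁰_df`-mild —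
Fourier-side Sobolev calculus on `ℝ³`, the trilinear form, the heat pairing and the tested Duhamel identity, `H¹⁰` membership and
continuity; uniqueness of `H¹⁰_df`-mild solutions through the weighted bilinear Duhamel operator; and the blow-up dictionary: no
global Kato solution, the Kato maximal time, gluing of Tao-class solutions, Leray–Hopf by weak–strong comparison, maximality by
the singular point) — until now Summits-side only (`Summits/NavierStokesRegularity/NavierStokesRegularity/Theorems/FluidComputerCascade.lean`,
`mildMaximalGivesBlowup_holds := pumpContinuation_mildBlowupClassical_proof`).  RE-HOMED into `Literature/` by the Hodge foundations
lane (`lit-hodgefound`, prover p20, generation 39) as THREE files: verbatim DECLARATION-LEVEL ports (the 187 declarations the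
discharge needs, in dependency order; each Part header lists the declarations of its source module that are NOT carried) of 24
Summits modules `Summits/NavierStokesRegularity/NavierStokesRegularity/Theorems/{PerpetualPumpEulerTypeIGlue*,PerpetualPumpThesis*,PumpContinuationMildBlowupClassical}.lean`,
namespaces `Summit.NavierStokesRegularity.NavierStokesRegularity.Theorems{,.…}` re-rooted to `Literature.Analysis.PerpetualPump{,.…}`
(a root outside `Literature.Analysis.FluidPDE` on purpose: namespace-prefix resolution would otherwise shadow the cone's lemmas by
same-named `FluidPDE` lemmas); the three `local notation`s of the sources (`ℝ³`, `ℂ³`, `𝐞ᵤ i`) are expanded textually; imports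
from `Literature/` and Mathlib only; no `sorry`, no new axiom, NO named fact (D-0026).  ONE deliberate deviation: the source states
`pumpContinuation_mildBlowupClassical_proof : Theses.PumpContinuation.MildBlowupClassical` (a Summits route Prop, by the fact's own
docstring VERBATIM the same statement); here its type is written as the Literature fact `FluidComputer.MildMaximalGivesBlowup`
itself (identical binders, identical proof script).  PROVENANCE CONVENTION: docstrings are carried byte-for-byte; declarations the
cell cites keep their cites; `[folklore]`-tagged and untagged declarations (the cell's own lemmas) carry the Part's tag
`[cite: <Key>, <loc> (source of the NOTION / ARGUMENT this module implements; this declaration is the cell's own lemma or plumbing,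
NOT a printed statement)]`, because the gate does not admit a public Literature theorem without a cite tag.

THIS FILE (1 of 3) ports: PerpetualPumpEulerTypeIGlueFourierL2, PerpetualPumpEulerTypeIGlueFourierDeriv, PerpetualPumpEulerTypeIGlueTripleProduct, PerpetualPumpEulerTypeIGlueTrilinearPrep, PerpetualPumpEulerTypeIGlueCubic, PerpetualPumpEulerTypeIGlueHeatPairing, PerpetualPumpEulerTypeIGlueDensity, PerpetualPumpEulerTypeIGlueIdentityTests, PerpetualPumpEulerTypeIGlueDuhamel.
-/

noncomputable section

/-!
## Part 1 — port of `Summits/NavierStokesRegularity/NavierStokesRegularity/Theorems/PerpetualPumpEulerTypeIGlueFourierL2.lean` (1 declarations kept)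

# Route PerpetualPump · `EulerTypeIGlue` — toolkit I: `𝓕L¹ ⊂ L^∞` for `L²` classes and the
# embedding `H¹⁰(ℝ³) ⊂ L^∞`

Support file for the support item `EulerTypeIGlue` (stmt-NavierStokesRegularity-1838) of route
PerpetualPump. In Tao's `H¹⁰_df` setting (`Literature/Analysis/FluidPDE/TaoAveragedSobolev.lean`)
the Fourier transform is Mathlib's Plancherel isometry of `L²(E; F)`; on `L¹ ∩ L²` it is the
Fourier integral (tree: `Literature.Analysis.FunctionSpaces.fourier_toLp_ae_eq_fourierIntegral`,
`…SobolevEmbeddingHalf.fourierInv_toLp_ae_eq_fourierIntegralInv`). Consequences recorded here: an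
`L²` class whose transform is integrable is a.e. the inverse Fourier integral of its transform
(`coeFn_ae_eq_fourierInv`), hence essentially bounded by `‖𝓕f‖₁`, and the embedding
`‖w‖_{L^∞} ≤ (∫(1+|ξ|²)^{-10})^{1/2} ‖w‖_{H¹⁰}` on `L²(ℝ³; ℂ³)` (`H¹⁰ ⊂ 𝓕L¹`, the tree's
`Tao2016.lintegral_enorm_le_sobolevWeight`).

## References

* E. M. Stein, G. Weiss, *Introduction to Fourier Analysis on Euclidean Spaces* (1971), Ch. I,
  Thm. 2.3 (Plancherel; the `L²` transform agrees with the integral on `L¹ ∩ L²`).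
* T. Tao, J. Amer. Math. Soc. 29 (2016), arXiv:1402.0290v3, §1.1 (`H¹⁰_df`). [Tao2016AveragedNS]

Not carried from this source module (not needed by the declarations re-homed here; their consumers are Summits-side): `eLpNorm_top_le_lintegral_enorm_fourier`, `sobolevTen_const_pos`, `eLpNorm_top_le_sobolevTen`.
-/

section Part1

open _root_.MeasureTheory _root_.Set _root_.Filter _root_.Topology FourierTransform SchwartzMap
open scoped _root_.ENNReal _root_.NNReal FourierTransform RealInnerProductSpace _root_.ContDiff

namespace Literature.Analysis.PerpetualPump.PerpetualPumpEulerTypeIGlue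

section General

variable {V : Type*} [NormedAddCommGroup V] [InnerProductSpace ℝ V] [FiniteDimensional ℝ V]
  [MeasurableSpace V] [BorelSpace V]
variable {F : Type*} [NormedAddCommGroup F] [InnerProductSpace ℂ F] [CompleteSpace F]

/-- An `L²` class whose `L²` Fourier transform has an integrable representative is a.e. the
inverse Fourier integral of that representative. [folklore]
[cite: Tao2016AveragedNS, §1.1 (1.3)–(1.5), (1.15) pp. 3–7 (the `H¹⁰_df` mild formulation of the true Navier–Stokes form and its Fourier-side calculus) (source of the NOTION / ARGUMENT this module implements; this declaration is the cell’s own lemma or plumbing, NOT a printed statement)] -/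
theorem coeFn_ae_eq_fourierInv (f : Lp F 2 (volume : Measure V))
    (hint : Integrable ((𝓕 f : Lp F 2 (volume : Measure V)) : V → F)) :
    (f : V → F) =ᵐ[volume] 𝓕⁻ ((𝓕 f : Lp F 2 (volume : Measure V)) : V → F) := by
  set G : V → F := ((𝓕 f : Lp F 2 (volume : Measure V)) : V → F) with hG
  have hG2 : MemLp G 2 volume := Lp.memLp _
  have hGf : hG2.toLp G = (𝓕 f : Lp F 2 (volume : Measure V)) := Lp.toLp_coeFn _ hG2
  have hf : f = 𝓕⁻ (hG2.toLp G) := by rw [hGf, fourierInv_fourier_eq]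
  have h := Literature.Analysis.FunctionSpaces.SobolevEmbeddingHalf.fourierInv_toLp_ae_eq_fourierIntegralInv
    hint hG2
  rw [← hf] at h
  exact h

end General

/-! ### `H¹⁰(ℝ³; ℂ³) ⊂ L^∞` -/

open Literature.Analysis.FluidPDE.Tao2016

end Literature.Analysis.PerpetualPump.PerpetualPumpEulerTypeIGlue

end Part1

/-!
## Part 2 — port of `Summits/NavierStokesRegularity/NavierStokesRegularity/Theorems/PerpetualPumpEulerTypeIGlueFourierDeriv.lean` (10 declarations kept)

# Route PerpetualPump · `EulerTypeIGlue` — toolkit II: derivatives under the `L²` Fourier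
# transform (physical → Fourier transfer of Sobolev regularity)

Support file for the support item `EulerTypeIGlue` (stmt-NavierStokesRegularity-1838). The
dictionary between classical Navier–Stokes solutions and Tao's `H¹⁰_df`-mild solutions needs the
elementary fact that for a `C¹` function `f` with `f, ∂_m f ∈ L²` the Plancherel transform of
`∂_m f` is `2πi ⟨ξ, m⟩ f̂(ξ)` — for functions that are **not** integrable (finite-energy solutions
are `H^k`, not `L¹`), so that the Fourier integral is unavailable. The proof goes through
Mathlib's tempered distributions: `T_{∂_m f} = ∂_m T_f` (integration by parts against Schwartz
functions, Mathlib `integral_smul_fderiv_eq_neg_fderiv_smul_of_integrable`), Mathlib's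
`TemperedDistribution.fourier_lineDerivOp_eq`, the compatibility of the `L²` and `𝓢'` transforms
(`MeasureTheory.Lp.fourier_toTemperedDistribution_eq`), and the injectivity of `L^p → 𝓢'` after
multiplication by the bounded weight `(1+|ξ|²)⁻¹` (`MeasureTheory.Lp.toTemperedDistribution_smul_eq`).
Iterating along a fixed direction gives `𝓕[(∂_m)^k f] = (2πi⟨ξ,m⟩)^k 𝓕[f]` and the weighted
Plancherel bound `∫ |2π⟨ξ,m⟩|^{2k} |f̂|² = ‖(∂_m)^k f‖²_{L²} ≤ ‖m‖^{2k} ‖D^k f‖²_{L²}`. Also: the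
`L²` transform commutes with continuous linear maps of the range.

## References

* E. M. Stein, G. Weiss, *Introduction to Fourier Analysis on Euclidean Spaces* (1971), Ch. I
  §1 (Thm. 1.8: `(∂f)^ = 2πi ξ f̂`) and §3 (tempered distributions).
* T. Tao, J. Amer. Math. Soc. 29 (2016), arXiv:1402.0290v3, §1.1 p. 3 (`H¹⁰_df`: Sobolev
  regularity and divergence read on the Fourier side). [Tao2016AveragedNS]
-/

section Part2

open _root_.MeasureTheory _root_.Set _root_.Filter _root_.Topology FourierTransform SchwartzMap TemperedDistribution
open scoped _root_.ENNReal _root_.NNReal FourierTransform RealInnerProductSpace _root_.ContDiff LineDeriv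

namespace Literature.Analysis.PerpetualPump.PerpetualPumpEulerTypeIGlue

variable {V : Type*} [NormedAddCommGroup V] [InnerProductSpace ℝ V] [FiniteDimensional ℝ V]
  [MeasurableSpace V] [BorelSpace V]
variable {F : Type*} [NormedAddCommGroup F] [InnerProductSpace ℂ F] [CompleteSpace F]
variable {F' : Type*} [NormedAddCommGroup F'] [InnerProductSpace ℂ F'] [CompleteSpace F']

/-! ### Integrability of Schwartz-weighted `L²` functions -/

omit [CompleteSpace F] in
/-- `g • h ∈ L¹` for a Schwartz scalar `g` and `h ∈ L²`. [folklore]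
[cite: Tao2016AveragedNS, §1.1 (1.3)–(1.5), (1.15) pp. 3–7 (the `H¹⁰_df` mild formulation of the true Navier–Stokes form and its Fourier-side calculus) (source of the NOTION / ARGUMENT this module implements; this declaration is the cell’s own lemma or plumbing, NOT a printed statement)] -/
theorem integrable_schwartz_smul_of_memLp (g : 𝓢(V, ℂ)) {h : V → F} (hh : MemLp h 2 volume) :
    Integrable (fun x => g x • h x) volume := by
  have h2 : MemLp (⇑g) 2 (volume : Measure V) := g.memLp 2 volume
  have := MemLp.smul (p := 2) (q := 2) (r := 1) hh h2
  exact memLp_one_iff_integrable.1 this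

/-! ### The `L²` Fourier transform commutes with continuous linear maps of the range -/

/-- **`𝓕 (L ∘ u) = L ∘ 𝓕 u` on `L²`** (a.e. form) for a continuous `ℂ`-linear `L : F → F'`:
both sides induce the same tempered distribution. [folklore]
[cite: Tao2016AveragedNS, §1.1 (1.3)–(1.5), (1.15) pp. 3–7 (the `H¹⁰_df` mild formulation of the true Navier–Stokes form and its Fourier-side calculus) (source of the NOTION / ARGUMENT this module implements; this declaration is the cell’s own lemma or plumbing, NOT a printed statement)] -/
theorem fourier_compLp_ae_eq (L : F →L[ℂ] F') (u : Lp F 2 (volume : Measure V)) :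
    ((𝓕 (L.compLp u) : Lp F' 2 (volume : Measure V)) : V → F') =ᵐ[volume]
      fun ξ => L (((𝓕 u : Lp F 2 (volume : Measure V)) : V → F) ξ) := by
  have key : ∀ g : 𝓢(V, ℂ),
      ∫ x, g x • ((𝓕 (L.compLp u) : Lp F' 2 (volume : Measure V)) : V → F') x =
        ∫ x, g x • L (((𝓕 u : Lp F 2 (volume : Measure V)) : V → F) x) := by
    intro g
    -- left-hand side through `𝓢'`
    have h1 : ∫ x, g x • ((𝓕 (L.compLp u) : Lp F' 2 (volume : Measure V)) : V → F') x =
        ∫ x, (𝓕 g : 𝓢(V, ℂ)) x • ((L.compLp u : Lp F' 2 (volume : Measure V)) : V → F') x := by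
      rw [← Lp.toTemperedDistribution_apply, ← Lp.fourier_toTemperedDistribution_eq,
        TemperedDistribution.fourier_apply, Lp.toTemperedDistribution_apply]
    have h2 : ∫ x, (𝓕 g : 𝓢(V, ℂ)) x • ((L.compLp u : Lp F' 2 (volume : Measure V)) : V → F') x =
        ∫ x, L ((𝓕 g : 𝓢(V, ℂ)) x • (u : V → F) x) := by
      refine integral_congr_ae ?_
      filter_upwards [ContinuousLinearMap.coeFn_compLp L u] with x hx
      rw [hx, L.map_smul]
    have h3 : ∫ x, L ((𝓕 g : 𝓢(V, ℂ)) x • (u : V → F) x) = L (∫ x, (𝓕 g : 𝓢(V, ℂ)) x • (u : V → F) x) :=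
      ContinuousLinearMap.integral_comp_comm L (integrable_schwartz_smul_of_memLp (𝓕 g) (Lp.memLp u))
    -- right-hand side through `𝓢'`
    have h4 : ∫ x, (𝓕 g : 𝓢(V, ℂ)) x • (u : V → F) x =
        ∫ x, g x • ((𝓕 u : Lp F 2 (volume : Measure V)) : V → F) x := by
      rw [← Lp.toTemperedDistribution_apply, ← TemperedDistribution.fourier_apply,
        Lp.fourier_toTemperedDistribution_eq, Lp.toTemperedDistribution_apply]
    have h5 : L (∫ x, g x • ((𝓕 u : Lp F 2 (volume : Measure V)) : V → F) x) =
        ∫ x, L (g x • ((𝓕 u : Lp F 2 (volume : Measure V)) : V → F) x) :=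
      (ContinuousLinearMap.integral_comp_comm L (integrable_schwartz_smul_of_memLp g (Lp.memLp _))).symm
    rw [h1, h2, h3, h4, h5]
    refine integral_congr_ae (Eventually.of_forall fun x => ?_)
    simp only [L.map_smul]
  have hL2 : MemLp (fun ξ => L (((𝓕 u : Lp F 2 (volume : Measure V)) : V → F) ξ)) 2 volume :=
    ContinuousLinearMap.comp_memLp' L (Lp.memLp _)
  refine ae_eq_of_integral_contDiff_smul_eq ((Lp.memLp _).locallyIntegrable (by norm_num))
    (hL2.locallyIntegrable (by norm_num)) fun φ hφ hsupp => ?_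
  have hφc : HasCompactSupport fun x => ((φ x : ℝ) : ℂ) := hsupp.comp_left Complex.ofReal_zero
  have hφs : ContDiff ℝ ∞ fun x => ((φ x : ℝ) : ℂ) := Complex.ofRealCLM.contDiff.comp hφ
  have h := key (hφc.toSchwartzMap hφs)
  have hcoe : ∀ x, (hφc.toSchwartzMap hφs) x = ((φ x : ℝ) : ℂ) := fun x => rfl
  simp only [hcoe] at h
  simpa only [Complex.real_smul, Complex.coe_smul] using h

/-! ### `T_{∂_m f} = ∂_m T_f` for `C¹` functions with `f, ∂_m f ∈ L²` -/

/-- **Integration by parts in `𝓢'`**: for `f ∈ C¹(V; F)` with `f ∈ L²` and `∂_m f ∈ L²`, the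
tempered distribution of `∂_m f` is the distributional derivative `∂_m` of the distribution of
`f` (Mathlib's integration by parts for Fréchet derivatives against Schwartz functions). [folklore]
[cite: Tao2016AveragedNS, §1.1 (1.3)–(1.5), (1.15) pp. 3–7 (the `H¹⁰_df` mild formulation of the true Navier–Stokes form and its Fourier-side calculus) (source of the NOTION / ARGUMENT this module implements; this declaration is the cell’s own lemma or plumbing, NOT a printed statement)] -/
theorem toTemperedDistribution_fderiv_eq {f : V → F} (hf : ContDiff ℝ 1 f) (m : V)
    (hf2 : MemLp f 2 volume) (hd2 : MemLp (fun x => fderiv ℝ f x m) 2 volume) :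
    Lp.toTemperedDistribution (hd2.toLp _) =
      ∂_{m} (Lp.toTemperedDistribution (hf2.toLp f) : 𝓢'(V, F)) := by
  ext g
  rw [Lp.toTemperedDistribution_apply, TemperedDistribution.lineDerivOp_apply_apply,
    Lp.toTemperedDistribution_apply]
  have h1 : ∫ x, g x • (hd2.toLp _ : Lp F 2 (volume : Measure V)) x =
      ∫ x, g x • fderiv ℝ f x m := by
    refine integral_congr_ae ?_
    filter_upwards [hd2.coeFn_toLp] with x hx
    rw [hx]
  have h2 : ∫ x, (-∂_{m} g : 𝓢(V, ℂ)) x • (hf2.toLp f : Lp F 2 (volume : Measure V)) x =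
      -∫ x, fderiv ℝ (⇑g) x m • f x := by
    rw [← integral_neg]
    refine integral_congr_ae ?_
    filter_upwards [hf2.coeFn_toLp] with x hx
    rw [hx, neg_apply, SchwartzMap.lineDerivOp_apply_eq_fderiv, neg_smul]
  rw [h1, h2]
  -- integration by parts
  have hdg : MemLp (fun x => fderiv ℝ (⇑g) x m) 2 volume := by
    have hfun : (fun x => fderiv ℝ (⇑g) x m) = ⇑(∂_{m} g : 𝓢(V, ℂ)) :=
      funext fun x => (SchwartzMap.lineDerivOp_apply_eq_fderiv m g x).symm
    rw [hfun]
    exact (∂_{m} g : 𝓢(V, ℂ)).memLp 2 (volume : Measure V)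
  refine integral_smul_fderiv_eq_neg_fderiv_smul_of_integrable ?_ ?_ ?_ (fun x _ => g.differentiableAt)
    (fun x _ => (hf.differentiable one_ne_zero).differentiableAt)
  · have := MemLp.smul (p := 2) (q := 2) (r := 1) hf2 hdg
    exact memLp_one_iff_integrable.1 this
  · exact integrable_schwartz_smul_of_memLp g hd2
  · exact integrable_schwartz_smul_of_memLp g hf2

/-! ### Bounded multipliers and injectivity -/

omit [FiniteDimensional ℝ V] [MeasurableSpace V] [BorelSpace V] in
/-- The weight `(1+|ξ|²)^{-1}`, as a complex-valued function, has temperate growth. [folklore]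
[cite: Tao2016AveragedNS, §1.1 (1.3)–(1.5), (1.15) pp. 3–7 (the `H¹⁰_df` mild formulation of the true Navier–Stokes form and its Fourier-side calculus) (source of the NOTION / ARGUMENT this module implements; this declaration is the cell’s own lemma or plumbing, NOT a printed statement)] -/
theorem hasTemperateGrowth_sobolevWeight_neg_one :
    (fun ξ : V => (((1 + ‖ξ‖ ^ 2) ^ (-1 : ℝ) : ℝ) : ℂ)).HasTemperateGrowth := by
  fun_prop

omit [InnerProductSpace ℝ V] [FiniteDimensional ℝ V] [MeasurableSpace V] [BorelSpace V] in
/-- `(1+|ξ|²)^{-1} = (1+|ξ|²)⁻¹`. [folklore]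
[cite: Tao2016AveragedNS, §1.1 (1.3)–(1.5), (1.15) pp. 3–7 (the `H¹⁰_df` mild formulation of the true Navier–Stokes form and its Fourier-side calculus) (source of the NOTION / ARGUMENT this module implements; this declaration is the cell’s own lemma or plumbing, NOT a printed statement)] -/
theorem sobolevWeight_neg_one_eq (ξ : V) : (1 + ‖ξ‖ ^ 2) ^ (-1 : ℝ) = (1 + ‖ξ‖ ^ 2)⁻¹ :=
  Real.rpow_neg_one _

/-- The weight `(1+|ξ|²)^{-1}` is bounded by `1`, hence in `L^∞`. [folklore]
[cite: Tao2016AveragedNS, §1.1 (1.3)–(1.5), (1.15) pp. 3–7 (the `H¹⁰_df` mild formulation of the true Navier–Stokes form and its Fourier-side calculus) (source of the NOTION / ARGUMENT this module implements; this declaration is the cell’s own lemma or plumbing, NOT a printed statement)] -/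
theorem memLp_top_sobolevWeight_neg_one :
    MemLp (fun ξ : V => (((1 + ‖ξ‖ ^ 2) ^ (-1 : ℝ) : ℝ) : ℂ)) ⊤ (volume : Measure V) := by
  refine memLp_top_of_bound
    hasTemperateGrowth_sobolevWeight_neg_one.1.continuous.aestronglyMeasurable
    1 (Eventually.of_forall fun ξ => ?_)
  rw [Complex.norm_real, sobolevWeight_neg_one_eq, Real.norm_of_nonneg (by positivity)]
  exact inv_le_one_of_one_le₀ (le_add_of_nonneg_right (sq_nonneg _))

omit [FiniteDimensional ℝ V] [MeasurableSpace V] [BorelSpace V] in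
/-- The weighted coordinate `⟨ξ, m⟩ (1+|ξ|²)^{-1}`, as a complex-valued function, has
temperate growth. [folklore]
[cite: Tao2016AveragedNS, §1.1 (1.3)–(1.5), (1.15) pp. 3–7 (the `H¹⁰_df` mild formulation of the true Navier–Stokes form and its Fourier-side calculus) (source of the NOTION / ARGUMENT this module implements; this declaration is the cell’s own lemma or plumbing, NOT a printed statement)] -/
theorem hasTemperateGrowth_inner_mul_sobolevWeight (m : V) :
    (fun ξ : V => ((⟪ξ, m⟫ : ℝ) : ℂ) * (((1 + ‖ξ‖ ^ 2) ^ (-1 : ℝ) : ℝ) : ℂ)).HasTemperateGrowth := by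
  have h1 : (fun ξ : V => ((⟪ξ, m⟫ : ℝ) : ℂ)).HasTemperateGrowth := by fun_prop
  exact h1.mul hasTemperateGrowth_sobolevWeight_neg_one

/-- The weighted coordinate `⟨ξ, m⟩ (1+|ξ|²)^{-1}` is bounded by `‖m‖`, hence in `L^∞`. [folklore]
[cite: Tao2016AveragedNS, §1.1 (1.3)–(1.5), (1.15) pp. 3–7 (the `H¹⁰_df` mild formulation of the true Navier–Stokes form and its Fourier-side calculus) (source of the NOTION / ARGUMENT this module implements; this declaration is the cell’s own lemma or plumbing, NOT a printed statement)] -/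
theorem memLp_top_inner_mul_sobolevWeight (m : V) :
    MemLp (fun ξ : V => ((⟪ξ, m⟫ : ℝ) : ℂ) * (((1 + ‖ξ‖ ^ 2) ^ (-1 : ℝ) : ℝ) : ℂ)) ⊤
      (volume : Measure V) := by
  refine memLp_top_of_bound
    (hasTemperateGrowth_inner_mul_sobolevWeight m).1.continuous.aestronglyMeasurable
    ‖m‖ (Eventually.of_forall fun ξ => ?_)
  have hpos : 0 < (1 + ‖ξ‖ ^ 2)⁻¹ := inv_pos.2 (by positivity)
  rw [norm_mul, Complex.norm_real, Complex.norm_real, sobolevWeight_neg_one_eq, Real.norm_eq_abs,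
    Real.norm_eq_abs, abs_of_pos hpos]
  have h1 : |⟪ξ, m⟫| ≤ ‖ξ‖ * ‖m‖ := abs_real_inner_le_norm ξ m
  have h2 : ‖ξ‖ * (1 + ‖ξ‖ ^ 2)⁻¹ ≤ 1 := by
    rw [mul_inv_le_iff₀ (by positivity), one_mul]
    nlinarith [sq_nonneg (‖ξ‖ - 1), norm_nonneg ξ]
  calc |⟪ξ, m⟫| * (1 + ‖ξ‖ ^ 2)⁻¹ ≤ ‖ξ‖ * ‖m‖ * (1 + ‖ξ‖ ^ 2)⁻¹ := by gcongr
    _ = ‖m‖ * (‖ξ‖ * (1 + ‖ξ‖ ^ 2)⁻¹) := by ring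
    _ ≤ ‖m‖ * 1 := by gcongr
    _ = ‖m‖ := mul_one _

/-- Injectivity of `L² → 𝓢'`: two `L²` classes inducing the same tempered distribution are
equal (Mathlib `ker_toTemperedDistributionCLM_eq_bot`). [folklore]
[cite: Tao2016AveragedNS, §1.1 (1.3)–(1.5), (1.15) pp. 3–7 (the `H¹⁰_df` mild formulation of the true Navier–Stokes form and its Fourier-side calculus) (source of the NOTION / ARGUMENT this module implements; this declaration is the cell’s own lemma or plumbing, NOT a printed statement)] -/
theorem eq_of_toTemperedDistribution_eq {u v : Lp F 2 (volume : Measure V)}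
    (h : (Lp.toTemperedDistribution u : 𝓢'(V, F)) = Lp.toTemperedDistribution v) : u = v := by
  have hker := Lp.ker_toTemperedDistributionCLM_eq_bot (F := F) (μ := (volume : Measure V)) (p := 2)
  have hinj : Function.Injective (Lp.toTemperedDistributionCLM F (volume : Measure V) 2) :=
    LinearMap.ker_eq_bot.1 hker
  exact hinj h

/-! ### `𝓕[∂_m f] = 2πi⟨ξ,m⟩ 𝓕[f]` -/

/-- **The `L²` Fourier transform of a derivative**: for `f ∈ C¹(V; F)` with `f, ∂_m f ∈ L²`,
`𝓕[∂_m f](ξ) = 2πi ⟨ξ, m⟩ 𝓕[f](ξ)` for a.e. `ξ` (Plancherel transforms of the `L²` classes;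
Stein–Weiss Ch. I Thm. 1.8 in the `L²`/`𝓢'` setting). [folklore]
[cite: Tao2016AveragedNS, §1.1 (1.3)–(1.5), (1.15) pp. 3–7 (the `H¹⁰_df` mild formulation of the true Navier–Stokes form and its Fourier-side calculus) (source of the NOTION / ARGUMENT this module implements; this declaration is the cell’s own lemma or plumbing, NOT a printed statement)] -/
theorem fourier_toLp_fderiv_ae_eq {f : V → F} (hf : ContDiff ℝ 1 f) (m : V)
    (hf2 : MemLp f 2 volume) (hd2 : MemLp (fun x => fderiv ℝ f x m) 2 volume) :
    ((𝓕 (hd2.toLp _) : Lp F 2 (volume : Measure V)) : V → F) =ᵐ[volume]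
      fun ξ => ((2 * Real.pi * Complex.I) * ((⟪ξ, m⟫ : ℝ) : ℂ)) •
        ((𝓕 (hf2.toLp f) : Lp F 2 (volume : Measure V)) : V → F) ξ := by
  set A : Lp F 2 (volume : Measure V) := 𝓕 (hd2.toLp _) with hA
  set B : Lp F 2 (volume : Measure V) := 𝓕 (hf2.toLp f) with hB
  set ρ : V → ℂ := fun ξ => (((1 + ‖ξ‖ ^ 2) ^ (-1 : ℝ) : ℝ) : ℂ) with hρ
  set χ : V → ℂ := fun ξ => ((⟪ξ, m⟫ : ℝ) : ℂ) * (((1 + ‖ξ‖ ^ 2) ^ (-1 : ℝ) : ℝ) : ℂ) with hχ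
  have hρt : ρ.HasTemperateGrowth := hasTemperateGrowth_sobolevWeight_neg_one
  have hχt : χ.HasTemperateGrowth := hasTemperateGrowth_inner_mul_sobolevWeight m
  have hρi : MemLp ρ ⊤ (volume : Measure V) := memLp_top_sobolevWeight_neg_one
  have hχi : MemLp χ ⊤ (volume : Measure V) := memLp_top_inner_mul_sobolevWeight m
  have hinner : (fun ξ : V => ((⟪ξ, m⟫ : ℝ) : ℂ)).HasTemperateGrowth := by fun_prop
  -- the distributional identity `T_A = 2πi • ⟨·,m⟩ T_B`
  have hdist : (Lp.toTemperedDistribution A : 𝓢'(V, F)) =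
      (2 * Real.pi * Complex.I) • smulLeftCLM F (fun ξ : V => ((⟪ξ, m⟫ : ℝ) : ℂ))
        (Lp.toTemperedDistribution B) := by
    rw [hA, ← Lp.fourier_toTemperedDistribution_eq, toTemperedDistribution_fderiv_eq hf m hf2 hd2,
      TemperedDistribution.fourier_lineDerivOp_eq, Lp.fourier_toTemperedDistribution_eq]
  -- multiply by the bounded weight `ρ`
  have hwt : (Lp.toTemperedDistribution ((hρi.toLp ρ) • A : Lp F 2 (volume : Measure V)) :
      𝓢'(V, F)) = Lp.toTemperedDistribution
        ((2 * Real.pi * Complex.I) • ((hχi.toLp χ) • B : Lp F 2 (volume : Measure V))) := by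
    rw [Lp.toTemperedDistribution_smul_eq hρt hρi A, hdist, map_smul,
      ← Lp.toTemperedDistributionCLM_apply (F := F) (μ := (volume : Measure V)) (p := 2)
        ((2 * Real.pi * Complex.I) • ((hχi.toLp χ) • B : Lp F 2 (volume : Measure V))),
      map_smul, Lp.toTemperedDistributionCLM_apply, Lp.toTemperedDistribution_smul_eq hχt hχi B,
      TemperedDistribution.smulLeftCLM_smulLeftCLM_apply hinner hρt]
    rfl
  have heq := eq_of_toTemperedDistribution_eq hwt
  -- read off a.e.
  filter_upwards [Lp.coeFn_lpSMul (r := 2) (hρi.toLp ρ) A, Lp.coeFn_lpSMul (r := 2) (hχi.toLp χ) B,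
    hρi.coeFn_toLp, hχi.coeFn_toLp,
    Lp.coeFn_smul (2 * Real.pi * Complex.I) ((hχi.toLp χ) • B : Lp F 2 (volume : Measure V)),
    (Lp.ext_iff.1 heq)] with ξ h1 h2 h3 h4 h5 h6
  have hρξ : ρ ξ ≠ 0 := by
    show (((1 + ‖ξ‖ ^ 2) ^ (-1 : ℝ) : ℝ) : ℂ) ≠ 0
    rw [ne_eq, Complex.ofReal_eq_zero]
    exact (Real.rpow_pos_of_pos (by positivity) _).ne'
  have e1 : ρ ξ • (A : V → F) ξ = (2 * Real.pi * Complex.I) • (χ ξ • (B : V → F) ξ) := by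
    have := h6
    rw [h1, Pi.smul_apply', h3, h5, Pi.smul_apply, h2, Pi.smul_apply', h4] at this
    exact this
  have e2 : χ ξ = ((⟪ξ, m⟫ : ℝ) : ℂ) * ρ ξ := rfl
  rw [e2, smul_smul, show (2 * Real.pi * Complex.I) * (((⟪ξ, m⟫ : ℝ) : ℂ) * ρ ξ) =
    ρ ξ * ((2 * Real.pi * Complex.I) * ((⟪ξ, m⟫ : ℝ) : ℂ)) by ring, ← smul_smul] at e1
  exact smul_right_injective F hρξ e1

end Literature.Analysis.PerpetualPump.PerpetualPumpEulerTypeIGlue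

end Part2

/-!
## Part 3 — port of `Summits/NavierStokesRegularity/NavierStokesRegularity/Theorems/PerpetualPumpEulerTypeIGlueTripleProduct.lean` (8 declarations kept)

# Route PerpetualPump · `EulerTypeIGlue` — toolkit VI: the triple product formula
# `∫ a b c = ∫∫ â(ξ₁) b̂(ξ₂) ĉ(-ξ₁-ξ₂)`

Support file for the support item `EulerTypeIGlue` (stmt-NavierStokesRegularity-1838). The
identification of Tao's Fourier-side Euler form (1.3) with the physical-space trilinear form
`∫ ⟪u, (u·∇)ψ⟫` rests on the elementary Plancherel-type formula for a product of three
functions: if `a`, `b` are (a.e.) the inverse Fourier integrals of integrable `A`, `B`, and `c`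
is integrable, then `∫ a(x) b(x) c(x) dx = ∫∫ A(ξ₁) B(ξ₂) ĉ(-ξ₁-ξ₂) dξ₁ dξ₂`. It is proved with
Mathlib's multiplication formula `∫ (𝓕 g) w = ∫ g (𝓕 w)`
(`VectorFourier.integral_fourierIntegral_smul_eq_flip`) applied twice and the modulation rule
`𝓕(e^{-2πi⟨·,η⟩} c)(ξ) = ĉ(ξ + η)`; no pointwise Fourier inversion is needed.

## References

* E. M. Stein, G. Weiss, *Introduction to Fourier Analysis on Euclidean Spaces* (1971), Ch. I
  §1, Thm. 1.15 (multiplication formula) and (1.6)–(1.7).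
* T. Tao, J. Amer. Math. Soc. 29 (2016), arXiv:1402.0290v3, §1.1 (1.3) ("which one can write
  in Fourier space as …"). [Tao2016AveragedNS]
-/

section Part3

open _root_.MeasureTheory _root_.Set _root_.Filter _root_.Topology FourierTransform
open scoped _root_.ENNReal _root_.NNReal FourierTransform RealInnerProductSpace

namespace Literature.Analysis.PerpetualPump.PerpetualPumpEulerTypeIGlue

variable {V : Type*} [NormedAddCommGroup V] [InnerProductSpace ℝ V] [FiniteDimensional ℝ V]
  [MeasurableSpace V] [BorelSpace V]

/-! ### Characters and modulation -/

/-- The multiplication formula `∫ (𝓕 g) • w = ∫ g • (𝓕 w)` for integrable scalar `g`, `w`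
(Mathlib `VectorFourier.integral_fourierIntegral_smul_eq_flip`). [folklore]
[cite: Tao2016AveragedNS, §1.1 (1.3)–(1.5), (1.15) pp. 3–7 (the `H¹⁰_df` mild formulation of the true Navier–Stokes form and its Fourier-side calculus) (source of the NOTION / ARGUMENT this module implements; this declaration is the cell’s own lemma or plumbing, NOT a printed statement)] -/
theorem integral_fourier_mul_eq_of_integrable {w g : V → ℂ} (hw : Integrable w) (hg : Integrable g) :
    ∫ x, (𝓕 g) x * w x = ∫ ξ, g ξ * (𝓕 w) ξ := by
  have h := VectorFourier.integral_fourierIntegral_smul_eq_flip (e := 𝐞) (μ := volume)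
    (ν := volume) (L := innerₗ V) (f := g) (g := w) Real.continuous_fourierChar
    continuous_inner hg hw
  have hflip : (innerₗ V).flip = innerₗ V := by
    ext v w'
    rw [LinearMap.flip_apply, innerₗ_apply_apply, innerₗ_apply_apply, real_inner_comm]
  rw [hflip] at h
  simp only [smul_eq_mul] at h
  exact h

omit [FiniteDimensional ℝ V] [MeasurableSpace V] [BorelSpace V] in
/-- The character `x ↦ e^{-2πi⟨x,η⟩}` is continuous. [folklore]
[cite: Tao2016AveragedNS, §1.1 (1.3)–(1.5), (1.15) pp. 3–7 (the `H¹⁰_df` mild formulation of the true Navier–Stokes form and its Fourier-side calculus) (source of the NOTION / ARGUMENT this module implements; this declaration is the cell’s own lemma or plumbing, NOT a printed statement)] -/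
theorem continuous_fourierChar_neg_inner (η : V) :
    Continuous fun x : V => ((𝐞 (-⟪x, η⟫) : Circle) : ℂ) :=
  continuous_subtype_val.comp (Real.continuous_fourierChar.comp (continuous_id.inner continuous_const).neg)

/-- A modulated integrable function is integrable. [folklore]
[cite: Tao2016AveragedNS, §1.1 (1.3)–(1.5), (1.15) pp. 3–7 (the `H¹⁰_df` mild formulation of the true Navier–Stokes form and its Fourier-side calculus) (source of the NOTION / ARGUMENT this module implements; this declaration is the cell’s own lemma or plumbing, NOT a printed statement)] -/
theorem integrable_fourierChar_mul {c : V → ℂ} (hc : Integrable c) (η : V) :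
    Integrable (fun x : V => ((𝐞 (-⟪x, η⟫) : Circle) : ℂ) * c x) := by
  refine Integrable.mono' hc.norm ((continuous_fourierChar_neg_inner η).aestronglyMeasurable.mul hc.1)
    (Eventually.of_forall fun x => ?_)
  rw [norm_mul, Circle.norm_coe, one_mul]

/-- **Modulation rule**: `𝓕(e^{-2πi⟨·,η⟩} c)(ξ) = ĉ(ξ + η)`. [folklore]
[cite: Tao2016AveragedNS, §1.1 (1.3)–(1.5), (1.15) pp. 3–7 (the `H¹⁰_df` mild formulation of the true Navier–Stokes form and its Fourier-side calculus) (source of the NOTION / ARGUMENT this module implements; this declaration is the cell’s own lemma or plumbing, NOT a printed statement)] -/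
theorem fourier_fourierChar_mul (c : V → ℂ) (η ξ : V) :
    𝓕 (fun x : V => ((𝐞 (-⟪x, η⟫) : Circle) : ℂ) * c x) ξ = 𝓕 c (ξ + η) := by
  rw [Real.fourier_eq, Real.fourier_eq]
  refine integral_congr_ae (Eventually.of_forall fun x => ?_)
  simp only [Circle.smul_def, Real.fourierChar_apply, smul_eq_mul, inner_add_right, neg_add]
  rw [← mul_assoc, ← Complex.exp_add]
  congr 1
  push_cast
  ring

/-! ### Inverse Fourier integrals of integrable functions -/

/-- The product of a bounded continuous function with an integrable one is integrable. [folklore]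
[cite: Tao2016AveragedNS, §1.1 (1.3)–(1.5), (1.15) pp. 3–7 (the `H¹⁰_df` mild formulation of the true Navier–Stokes form and its Fourier-side calculus) (source of the NOTION / ARGUMENT this module implements; this declaration is the cell’s own lemma or plumbing, NOT a printed statement)] -/
theorem integrable_mul_of_norm_le {k c : V → ℂ} (hk : Continuous k) {K : ℝ} (hK : ∀ x, ‖k x‖ ≤ K)
    (hc : Integrable c) : Integrable (fun x => k x * c x) := by
  refine Integrable.mono' (hc.norm.const_mul K) (hk.aestronglyMeasurable.mul hc.1)
    (Eventually.of_forall fun x => ?_)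
  rw [norm_mul]
  exact mul_le_mul_of_nonneg_right (hK x) (norm_nonneg _)

/-! ### The triple product formula -/

/-- **First multiplication step**: `∫ (𝓕⁻¹A) k = ∫ A(ξ) 𝓕k(-ξ)` for integrable `A`, `k`. [folklore]
[cite: Tao2016AveragedNS, §1.1 (1.3)–(1.5), (1.15) pp. 3–7 (the `H¹⁰_df` mild formulation of the true Navier–Stokes form and its Fourier-side calculus) (source of the NOTION / ARGUMENT this module implements; this declaration is the cell’s own lemma or plumbing, NOT a printed statement)] -/
theorem integral_fourierInv_mul_eq {A k : V → ℂ} (hA : Integrable A) (hk : Integrable k) :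
    ∫ x, 𝓕⁻ A x * k x = ∫ ξ, A ξ * 𝓕 k (-ξ) := by
  rw [Real.fourierInv_eq_fourier_comp_neg, integral_fourier_mul_eq_of_integrable hk hA.comp_neg]
  rw [← integral_neg_eq_self]
  simp only [neg_neg]

/-- **Second multiplication step**: `𝓕((𝓕⁻¹B) c)(η) = ∫ B(ξ₂) ĉ(η - ξ₂) dξ₂` for integrable `B`, `c`. [folklore]
[cite: Tao2016AveragedNS, §1.1 (1.3)–(1.5), (1.15) pp. 3–7 (the `H¹⁰_df` mild formulation of the true Navier–Stokes form and its Fourier-side calculus) (source of the NOTION / ARGUMENT this module implements; this declaration is the cell’s own lemma or plumbing, NOT a printed statement)] -/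
theorem fourier_fourierInv_mul_eq {B c : V → ℂ} (hB : Integrable B) (hc : Integrable c) (η : V) :
    𝓕 (fun x => 𝓕⁻ B x * c x) η = ∫ ξ, B ξ * 𝓕 c (η - ξ) := by
  -- `𝓕((𝓕⁻¹B) c)(η) = ∫ (𝓕⁻¹B)(x) (e^{-2πi⟨x,η⟩} c(x)) dx`
  have h1 : 𝓕 (fun x => 𝓕⁻ B x * c x) η =
      ∫ x, 𝓕⁻ B x * (((𝐞 (-⟪x, η⟫) : Circle) : ℂ) * c x) := by
    rw [Real.fourier_eq]
    refine integral_congr_ae (Eventually.of_forall fun x => ?_)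
    simp only [Circle.smul_def, smul_eq_mul]
    ring
  rw [h1, integral_fourierInv_mul_eq hB (integrable_fourierChar_mul hc η)]
  refine integral_congr_ae (Eventually.of_forall fun ξ => ?_)
  dsimp only
  erw [fourier_fourierChar_mul c η (-ξ)]
  rw [neg_add_eq_sub]

/-- **The triple product formula.** Let `A`, `B`, `c` be integrable on `V`, and let `a`, `b` agree
a.e. with the inverse Fourier integrals `𝓕⁻¹A`, `𝓕⁻¹B`. Then
`∫ a(x) b(x) c(x) dx = ∫∫ A(ξ₁) B(ξ₂) ĉ(-ξ₁-ξ₂) dξ₁ dξ₂`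
(the Fourier transform turns the pointwise product into the convolution on `ξ₁ + ξ₂ + ξ₃ = 0`;
Stein–Weiss Ch. I §1). [folklore]
[cite: Tao2016AveragedNS, §1.1 (1.3)–(1.5), (1.15) pp. 3–7 (the `H¹⁰_df` mild formulation of the true Navier–Stokes form and its Fourier-side calculus) (source of the NOTION / ARGUMENT this module implements; this declaration is the cell’s own lemma or plumbing, NOT a printed statement)] -/
theorem integral_mul_mul_eq_integral_prod {a b c A B : V → ℂ} (hA : Integrable A) (hB : Integrable B)
    (hc : Integrable c) (ha : a =ᵐ[volume] 𝓕⁻ A) (hb : b =ᵐ[volume] 𝓕⁻ B) :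
    ∫ x, a x * b x * c x = ∫ p : V × V, A p.1 * B p.2 * 𝓕 c (-p.1 - p.2) := by
  -- replace `a`, `b` by the continuous representatives
  have hab : ∫ x, a x * b x * c x = ∫ x, 𝓕⁻ A x * (𝓕⁻ B x * c x) := by
    refine integral_congr_ae ?_
    filter_upwards [ha, hb] with x hx hy
    rw [hx, hy, mul_assoc]
  -- `k = (𝓕⁻¹B) c` is integrable
  have hk : Integrable (fun x => 𝓕⁻ B x * c x) :=
    integrable_mul_of_norm_le
      (Literature.Analysis.FunctionSpaces.SobolevEmbeddingHalf.continuous_fourierIntegralInv hB)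
      (Literature.Analysis.FunctionSpaces.SobolevEmbeddingHalf.norm_fourierIntegralInv_le_integral_norm B) hc
  rw [hab, integral_fourierInv_mul_eq hA hk]
  -- the inner Fourier transform
  have hinner : ∀ ξ₁, 𝓕 (fun x => 𝓕⁻ B x * c x) (-ξ₁) = ∫ ξ₂, B ξ₂ * 𝓕 c (-ξ₁ - ξ₂) := fun ξ₁ =>
    fourier_fourierInv_mul_eq hB hc (-ξ₁)
  simp_rw [hinner]
  -- Fubini
  have hbound : ∀ ξ, ‖𝓕 c ξ‖ ≤ ∫ x, ‖c x‖ := fun ξ =>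
    VectorFourier.norm_fourierIntegral_le_integral_norm 𝐞 volume (innerₗ V) c ξ
  have hFc : Continuous (𝓕 c) :=
    VectorFourier.fourierIntegral_continuous Real.continuous_fourierChar continuous_inner hc
  have hint : Integrable (fun p : V × V => A p.1 * B p.2 * 𝓕 c (-p.1 - p.2)) (volume.prod volume) := by
    have hprod : Integrable (fun p : V × V => A p.1 * B p.2) (volume.prod volume) := hA.mul_prod hB
    refine Integrable.mono' (hprod.norm.mul_const (∫ x, ‖c x‖)) ?_ (Eventually.of_forall fun p => ?_)
    · exact hprod.1.mul ((hFc.comp (continuous_fst.neg.sub continuous_snd)).aestronglyMeasurable)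
    · rw [norm_mul]
      exact mul_le_mul_of_nonneg_left (hbound _) (norm_nonneg _)
  rw [Measure.volume_eq_prod, integral_prod _ hint]
  refine integral_congr_ae (Eventually.of_forall fun ξ₁ => ?_)
  dsimp only
  rw [← integral_const_mul]
  refine integral_congr_ae (Eventually.of_forall fun ξ₂ => ?_)
  ring

end Literature.Analysis.PerpetualPump.PerpetualPumpEulerTypeIGlue

end Part3

/-!
## Part 4 — port of `Summits/NavierStokesRegularity/NavierStokesRegularity/Theorems/PerpetualPumpEulerTypeIGlueTrilinearPrep.lean` (17 declarations kept)

# Route PerpetualPump · `EulerTypeIGlue` — preparations for the identification of Tao's Euler form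
# (1.3) with the physical trilinear form

Support file for the support item `EulerTypeIGlue` (stmt-NavierStokesRegularity-1838) of route
PerpetualPump.  Preparatory lemmas (components of real `L²` fields on the Fourier side, the Fourier
transform of derivatives of complexified test fields, `Σᵢⱼ` bookkeeping, dominated integrability on
`ℝ³ × ℝ³`) for the main result of the sibling file `PerpetualPumpEulerTypeIGlueTrilinear`,
`eulerForm_toLp_eq_integral_inner_convect`: for a continuous bounded
real field `f` whose complexified `L²` class lies in `H¹⁰` and is Fourier-divergence-free, and a
`C¹` test field `ψ` with `ψ, Dψ ∈ L¹`, `ψ^ℂ ∈ L²`,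
`⟨B([f^ℂ],[f^ℂ]), [ψ^ℂ]⟩ = ∫ ⟪f, (f·∇)ψ⟫ dx`, where `⟨B(·,·),·⟩ = eulerForm` is Tao's Fourier-side
form (1.3)–(1.4) (`Literature/Analysis/FluidPDE/TaoAveragedSobolev.lean`).  Proof: write both sides
as `∑ᵢⱼ`; each scalar term `∫ fⱼ fᵢ ∂ᵢψⱼ` is a triple product `∫ a b c` with `a = 𝓕⁻¹A`, `b = 𝓕⁻¹B`,
`A, B, c ∈ L¹`, computed on the Fourier side (`integral_mul_mul_eq_integral_prod`, toolkit VI);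
`𝓕[∂ᵢψⱼ] = 2πi ξᵢ ψ̂ⱼ`; the divergence-free condition `f̂(ξ)·ξ = 0` and the symmetry of the double
integral identify the result with `-πi ∫∫ Λ`.

## References

* T. Tao, J. Amer. Math. Soc. 29 (2016), arXiv:1402.0290v3, §1.1 (1.3)–(1.4). [Tao2016AveragedNS]
* E. M. Stein, G. Weiss, *Introduction to Fourier Analysis on Euclidean Spaces* (1971), Ch. I,
  Thm. 1.15 (multiplication formula), Thm. 1.8 (derivatives).
-/

section Part4

open _root_.MeasureTheory _root_.Set _root_.Filter _root_.Topology FourierTransform SchwartzMap TemperedDistribution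
open scoped _root_.ENNReal _root_.NNReal FourierTransform RealInnerProductSpace _root_.ContDiff LineDeriv

namespace Literature.Analysis.PerpetualPump.PerpetualPumpEulerTypeIGlue

/-! ## The Euler form of Tao (1.3) against a physical-space trilinear form -/

section Trilinear

open Literature.Analysis.FluidPDE Literature.Analysis.FluidPDE.Tao2016
open Literature.Analysis.FunctionSpaces (eFourierSobolevNorm)
open Literature.Analysis.FunctionSpaces.EuclideanSpace (complexify complexify_apply norm_complexify
  continuous_complexify)

/-! ### Small Fourier facts -/

/-- The inverse Fourier integral only depends on the a.e. class. [folklore]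
[cite: Tao2016AveragedNS, §1.1 (1.3)–(1.5), (1.15) pp. 3–7 (the `H¹⁰_df` mild formulation of the true Navier–Stokes form and its Fourier-side calculus) (source of the NOTION / ARGUMENT this module implements; this declaration is the cell’s own lemma or plumbing, NOT a printed statement)] -/
theorem fourierInv_congr_ae {F : Type*} [NormedAddCommGroup F] [NormedSpace ℂ F] {f g : (EuclideanSpace ℝ (Fin 3)) → F}
    (h : f =ᵐ[volume] g) : 𝓕⁻ f = 𝓕⁻ g := by
  funext x
  rw [Real.fourierInv_eq, Real.fourierInv_eq]
  refine integral_congr_ae ?_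
  filter_upwards [h] with v hv
  rw [hv]

/-- The Fourier integral commutes with a complex-linear map of the range. [folklore]
[cite: Tao2016AveragedNS, §1.1 (1.3)–(1.5), (1.15) pp. 3–7 (the `H¹⁰_df` mild formulation of the true Navier–Stokes form and its Fourier-side calculus) (source of the NOTION / ARGUMENT this module implements; this declaration is the cell’s own lemma or plumbing, NOT a printed statement)] -/
theorem fourier_clm_comp_apply {F F' : Type*} [NormedAddCommGroup F] [NormedSpace ℂ F] [CompleteSpace F]
    [NormedAddCommGroup F'] [NormedSpace ℂ F'] [CompleteSpace F'] (L : F →L[ℂ] F') {g : (EuclideanSpace ℝ (Fin 3)) → F}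
    (hg : Integrable g) (ξ : (EuclideanSpace ℝ (Fin 3))) : 𝓕 (fun x => L (g x)) ξ = L (𝓕 g ξ) := by
  rw [Real.fourier_eq, Real.fourier_eq, ← ContinuousLinearMap.integral_comp_comm L
    ((Real.fourierIntegral_convergent_iff ξ).2 hg)]
  refine integral_congr_ae (Eventually.of_forall fun v => ?_)
  dsimp only
  rw [Circle.smul_def, Circle.smul_def, L.map_smul]

/-- A coordinate of an integrable `ℂ³`-valued function is integrable. [folklore]
[cite: Tao2016AveragedNS, §1.1 (1.3)–(1.5), (1.15) pp. 3–7 (the `H¹⁰_df` mild formulation of the true Navier–Stokes form and its Fourier-side calculus) (source of the NOTION / ARGUMENT this module implements; this declaration is the cell’s own lemma or plumbing, NOT a printed statement)] -/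
theorem integrable_apply_of_integrable {G : (EuclideanSpace ℝ (Fin 3)) → (EuclideanSpace ℂ (Fin 3))} (hG : Integrable G) (j : Fin 3) :
    Integrable (fun ξ => G ξ j) :=
  (EuclideanSpace.proj j : (EuclideanSpace ℂ (Fin 3)) →L[ℂ] ℂ).integrable_comp hG

/-! ### The first moment of an `H¹⁰` Fourier transform is integrable -/

/-- `∫ (1+|ξ|²)^{-9} < ∞` on `ℝ³`. [folklore]
[cite: Tao2016AveragedNS, §1.1 (1.3)–(1.5), (1.15) pp. 3–7 (the `H¹⁰_df` mild formulation of the true Navier–Stokes form and its Fourier-side calculus) (source of the NOTION / ARGUMENT this module implements; this declaration is the cell’s own lemma or plumbing, NOT a printed statement)] -/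
theorem lintegral_sobolevWeight_neg_nine_lt_top :
    ∫⁻ ξ : (EuclideanSpace ℝ (Fin 3)), ENNReal.ofReal ((1 + ‖ξ‖ ^ 2) ^ (-9 : ℝ)) < ⊤ := by
  have h := integrable_rpow_neg_one_add_norm_sq (E := (EuclideanSpace ℝ (Fin 3))) (μ := (volume : Measure (EuclideanSpace ℝ (Fin 3)))) (r := 18)
    (by rw [finrank_euclideanSpace, Fintype.card_fin]; norm_num)
  have h' : Integrable (fun ξ : (EuclideanSpace ℝ (Fin 3)) => (1 + ‖ξ‖ ^ 2) ^ (-9 : ℝ)) := by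
    refine h.congr (Eventually.of_forall fun ξ => ?_)
    norm_num
  exact h'.lintegral_lt_top

/-- **`|ξ| û ∈ L¹` for `u ∈ H¹⁰`**: `∫ |ξ| |f(ξ)| ≤ (∫(1+|ξ|²)^{-9})^{1/2} (∫ (1+|ξ|²)^{10} |f|²)^{1/2}`. [folklore]
[cite: Tao2016AveragedNS, §1.1 (1.3)–(1.5), (1.15) pp. 3–7 (the `H¹⁰_df` mild formulation of the true Navier–Stokes form and its Fourier-side calculus) (source of the NOTION / ARGUMENT this module implements; this declaration is the cell’s own lemma or plumbing, NOT a printed statement)] -/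
theorem lintegral_norm_mul_enorm_le_sobolevWeight {f : (EuclideanSpace ℝ (Fin 3)) → (EuclideanSpace ℂ (Fin 3))} (hf : AEStronglyMeasurable f volume) :
    ∫⁻ ξ, ‖ξ‖ₑ * ‖f ξ‖ₑ ≤
      (∫⁻ ξ : (EuclideanSpace ℝ (Fin 3)), ENNReal.ofReal ((1 + ‖ξ‖ ^ 2) ^ (-9 : ℝ))) ^ (1 / 2 : ℝ) *
        sobolevWeightIntegral 10 f ^ (1 / 2 : ℝ) := by
  have hw : ∀ s : ℝ, Measurable fun ξ : (EuclideanSpace ℝ (Fin 3)) => ENNReal.ofReal ((1 + ‖ξ‖ ^ 2) ^ s) := measurable_sobolevWeight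
  unfold sobolevWeightIntegral
  -- `|ξ| ≤ (1+|ξ|²)^{-9/2} (1+|ξ|²)^{5}`
  have hpt : ∀ ξ : (EuclideanSpace ℝ (Fin 3)), ‖ξ‖ₑ ≤ ENNReal.ofReal ((1 + ‖ξ‖ ^ 2) ^ (-(9 : ℝ) / 2)) *
      ENNReal.ofReal ((1 + ‖ξ‖ ^ 2) ^ (5 : ℝ)) := by
    intro ξ
    have h0 : 0 < 1 + ‖ξ‖ ^ 2 := by positivity
    rw [← ENNReal.ofReal_mul (Real.rpow_nonneg h0.le _), ← Real.rpow_add h0, ← ofReal_norm]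
    refine ENNReal.ofReal_le_ofReal ?_
    have : -(9 : ℝ) / 2 + 5 = 1 / 2 := by norm_num
    rw [this, ← Real.sqrt_eq_rpow]
    refine Real.le_sqrt_of_sq_le ?_
    nlinarith [norm_nonneg ξ]
  have hsq : ∀ (s : ℝ) (ξ : (EuclideanSpace ℝ (Fin 3))),
      ENNReal.ofReal ((1 + ‖ξ‖ ^ 2) ^ s) ^ (2 : ℝ) = ENNReal.ofReal ((1 + ‖ξ‖ ^ 2) ^ (2 * s)) := by
    intro s ξ
    have h0 : 0 < 1 + ‖ξ‖ ^ 2 := by positivity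
    rw [ENNReal.ofReal_rpow_of_nonneg (Real.rpow_nonneg h0.le _) (by norm_num), ← Real.rpow_mul h0.le,
      mul_comm]
  calc ∫⁻ ξ, ‖ξ‖ₑ * ‖f ξ‖ₑ
      ≤ ∫⁻ ξ, ENNReal.ofReal ((1 + ‖ξ‖ ^ 2) ^ (-(9 : ℝ) / 2)) *
          (ENNReal.ofReal ((1 + ‖ξ‖ ^ 2) ^ (5 : ℝ)) * ‖f ξ‖ₑ) := by
        refine lintegral_mono fun ξ => ?_
        rw [← mul_assoc]
        exact mul_le_mul' (hpt ξ) le_rfl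
    _ ≤ (∫⁻ ξ, ENNReal.ofReal ((1 + ‖ξ‖ ^ 2) ^ (-(9 : ℝ) / 2)) ^ (2 : ℝ)) ^ (1 / (2 : ℝ)) *
          (∫⁻ ξ, (ENNReal.ofReal ((1 + ‖ξ‖ ^ 2) ^ (5 : ℝ)) * ‖f ξ‖ₑ) ^ (2 : ℝ)) ^ (1 / (2 : ℝ)) :=
        ENNReal.lintegral_mul_le_Lp_mul_Lq volume Real.HolderConjugate.two_two (hw _).aemeasurable
          ((hw _).aemeasurable.mul hf.enorm)
    _ = _ := by
        congr 2
        · refine lintegral_congr fun ξ => ?_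
          rw [hsq]
          norm_num
        · refine lintegral_congr fun ξ => ?_
          rw [ENNReal.mul_rpow_of_nonneg _ _ (by norm_num : (0 : ℝ) ≤ 2), hsq, ENNReal.rpow_two]
          norm_num

/-- For `u ∈ H¹⁰(ℝ³; ℂ³)`: `û ∈ L¹` and `|ξ| û ∈ L¹` (as real integrability statements). [folklore]
[cite: Tao2016AveragedNS, §1.1 (1.3)–(1.5), (1.15) pp. 3–7 (the `H¹⁰_df` mild formulation of the true Navier–Stokes form and its Fourier-side calculus) (source of the NOTION / ARGUMENT this module implements; this declaration is the cell’s own lemma or plumbing, NOT a printed statement)] -/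
theorem integrable_fourierFn_and_moment {u : L2C} (hu : eFourierSobolevNorm 10 u < ⊤) :
    Integrable (fourierFn u) ∧ Integrable (fun ξ : (EuclideanSpace ℝ (Fin 3)) => ‖ξ‖ * ‖fourierFn u ξ‖) := by
  have hmeas := aestronglyMeasurable_fourierFn u
  have hS : sobolevWeightIntegral 10 (fourierFn u) ^ (1 / 2 : ℝ) < ⊤ := by rw [← eFourierSobolevNorm_eq]; exact hu
  constructor
  · refine ⟨hmeas, ?_⟩
    refine lt_of_le_of_lt (lintegral_enorm_le_sobolevWeight hmeas) (ENNReal.mul_lt_top ?_ hS)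
    exact ENNReal.rpow_lt_top_of_nonneg (by norm_num) lintegral_inv_sobolevWeight_lt_top.ne
  · refine ⟨(continuous_norm.aestronglyMeasurable).mul hmeas.norm, ?_⟩
    have h1 : ∫⁻ ξ, ‖‖ξ‖ * ‖fourierFn u ξ‖‖ₑ = ∫⁻ ξ : (EuclideanSpace ℝ (Fin 3)), ‖ξ‖ₑ * ‖fourierFn u ξ‖ₑ := by
      refine lintegral_congr fun ξ => ?_
      rw [Real.enorm_eq_ofReal (by positivity), ENNReal.ofReal_mul (norm_nonneg _), ofReal_norm, ofReal_norm]
    rw [hasFiniteIntegral_iff_enorm, h1]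
    refine lt_of_le_of_lt (lintegral_norm_mul_enorm_le_sobolevWeight hmeas) (ENNReal.mul_lt_top ?_ hS)
    exact ENNReal.rpow_lt_top_of_nonneg (by norm_num) lintegral_sobolevWeight_neg_nine_lt_top.ne

/-! ### The components of a real `L²` field on the Fourier side -/

variable {f : (EuclideanSpace ℝ (Fin 3)) → (EuclideanSpace ℝ (Fin 3))}

/-- The `L²` class of the `j`-th complexified component is the projection of the class. [folklore]
[cite: Tao2016AveragedNS, §1.1 (1.3)–(1.5), (1.15) pp. 3–7 (the `H¹⁰_df` mild formulation of the true Navier–Stokes form and its Fourier-side calculus) (source of the NOTION / ARGUMENT this module implements; this declaration is the cell’s own lemma or plumbing, NOT a printed statement)] -/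
theorem coeFn_proj_compLp_toLp (h2 : MemLp (complexify ∘ f) 2 (volume : Measure (EuclideanSpace ℝ (Fin 3)))) (j : Fin 3) :
    (((EuclideanSpace.proj j : (EuclideanSpace ℂ (Fin 3)) →L[ℂ] ℂ).compLp (h2.toLp _) : Lp ℂ 2 (volume : Measure (EuclideanSpace ℝ (Fin 3)))) : (EuclideanSpace ℝ (Fin 3)) → ℂ)
      =ᵐ[volume] fun x => ((f x j : ℝ) : ℂ) := by
  filter_upwards [ContinuousLinearMap.coeFn_compLp (EuclideanSpace.proj j : (EuclideanSpace ℂ (Fin 3)) →L[ℂ] ℂ) (h2.toLp _),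
    h2.coeFn_toLp] with x hx hx'
  rw [hx, hx']
  simp [PiLp.proj_apply, complexify_apply]

/-- **A component of an `H¹⁰` real field is the inverse Fourier integral of the corresponding
component of its Fourier transform**: `f_j = 𝓕⁻¹(û_j)` a.e., `û = fourierFn [f^ℂ]`. [folklore]
[cite: Tao2016AveragedNS, §1.1 (1.3)–(1.5), (1.15) pp. 3–7 (the `H¹⁰_df` mild formulation of the true Navier–Stokes form and its Fourier-side calculus) (source of the NOTION / ARGUMENT this module implements; this declaration is the cell’s own lemma or plumbing, NOT a printed statement)] -/
theorem component_ae_eq_fourierInv (h2 : MemLp (complexify ∘ f) 2 (volume : Measure (EuclideanSpace ℝ (Fin 3))))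
    (hH : eFourierSobolevNorm 10 (h2.toLp _) < ⊤) (j : Fin 3) :
    (fun x => ((f x j : ℝ) : ℂ)) =ᵐ[volume] 𝓕⁻ (fun ξ => fourierFn (h2.toLp _) ξ j) := by
  set u : Lp ℂ 2 (volume : Measure (EuclideanSpace ℝ (Fin 3))) := (EuclideanSpace.proj j : (EuclideanSpace ℂ (Fin 3)) →L[ℂ] ℂ).compLp (h2.toLp _) with hu
  have hFu : ((𝓕 u : Lp ℂ 2 (volume : Measure (EuclideanSpace ℝ (Fin 3)))) : (EuclideanSpace ℝ (Fin 3)) → ℂ) =ᵐ[volume] fun ξ => fourierFn (h2.toLp _) ξ j := by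
    filter_upwards [fourier_compLp_ae_eq (EuclideanSpace.proj j : (EuclideanSpace ℂ (Fin 3)) →L[ℂ] ℂ) (h2.toLp (complexify ∘ f))]
      with ξ hξ
    rw [hu, hξ]
    rfl
  have hint : Integrable ((𝓕 u : Lp ℂ 2 (volume : Measure (EuclideanSpace ℝ (Fin 3)))) : (EuclideanSpace ℝ (Fin 3)) → ℂ) :=
    (integrable_apply_of_integrable (integrable_fourierFn_and_moment hH).1 j).congr hFu.symm
  have h := coeFn_ae_eq_fourierInv u hint
  rw [fourierInv_congr_ae hFu] at h
  exact (coeFn_proj_compLp_toLp h2 j).symm.trans h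

/-! ### The Fourier transform of the derivative of the complexified test field -/

variable {ψ : (EuclideanSpace ℝ (Fin 3)) → (EuclideanSpace ℝ (Fin 3))}

/-- The complexified test field and its derivative. [folklore]
[cite: Tao2016AveragedNS, §1.1 (1.3)–(1.5), (1.15) pp. 3–7 (the `H¹⁰_df` mild formulation of the true Navier–Stokes form and its Fourier-side calculus) (source of the NOTION / ARGUMENT this module implements; this declaration is the cell’s own lemma or plumbing, NOT a printed statement)] -/
theorem fderiv_complexify_comp_eq (hψ : Differentiable ℝ ψ) (x : (EuclideanSpace ℝ (Fin 3))) :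
    fderiv ℝ (complexify ∘ ψ) x = complexify.toContinuousLinearMap.comp (fderiv ℝ ψ x) := by
  rw [show (complexify ∘ ψ) = (⇑complexify.toContinuousLinearMap ∘ ψ) from rfl]
  exact (complexify.toContinuousLinearMap.hasFDerivAt.comp x (hψ x).hasFDerivAt).fderiv

/-- The derivative of the complexified test field is integrable when `Dψ` is. [folklore]
[cite: Tao2016AveragedNS, §1.1 (1.3)–(1.5), (1.15) pp. 3–7 (the `H¹⁰_df` mild formulation of the true Navier–Stokes form and its Fourier-side calculus) (source of the NOTION / ARGUMENT this module implements; this declaration is the cell’s own lemma or plumbing, NOT a printed statement)] -/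
theorem integrable_fderiv_complexify_comp (hψ : Differentiable ℝ ψ) (hψ' : Integrable (fderiv ℝ ψ)) :
    Integrable (fderiv ℝ (complexify ∘ ψ)) := by
  have h := ((ContinuousLinearMap.compL ℝ (EuclideanSpace ℝ (Fin 3)) (EuclideanSpace ℝ (Fin 3)) (EuclideanSpace ℂ (Fin 3))) complexify.toContinuousLinearMap).integrable_comp hψ'
  refine h.congr (Eventually.of_forall fun x => ?_)
  rw [fderiv_complexify_comp_eq hψ x]
  rfl

/-- **`𝓕[(∂_m ψ)^ℂ_j](ξ) = 2πi ⟨ξ, m⟩ 𝓕[ψ^ℂ](ξ)_j`** for an integrable `C¹` field with integrable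
derivative (Mathlib `Real.fourier_fderiv`). [folklore]
[cite: Tao2016AveragedNS, §1.1 (1.3)–(1.5), (1.15) pp. 3–7 (the `H¹⁰_df` mild formulation of the true Navier–Stokes form and its Fourier-side calculus) (source of the NOTION / ARGUMENT this module implements; this declaration is the cell’s own lemma or plumbing, NOT a printed statement)] -/
theorem fourier_component_fderiv (hψc : ContDiff ℝ 1 ψ) (hψ1 : Integrable (complexify ∘ ψ))
    (hψ' : Integrable (fderiv ℝ ψ)) (m ξ : (EuclideanSpace ℝ (Fin 3))) (j : Fin 3) :
    𝓕 (fun x => ((fderiv ℝ ψ x m j : ℝ) : ℂ)) ξ =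
      (2 * Real.pi * Complex.I) * ((⟪ξ, m⟫ : ℝ) : ℂ) * 𝓕 (complexify ∘ ψ) ξ j := by
  have hdiff : Differentiable ℝ ψ := hψc.differentiable one_ne_zero
  have hdiffc : Differentiable ℝ (complexify ∘ ψ) :=
    complexify.toContinuousLinearMap.differentiable.comp hdiff
  have hint := integrable_fderiv_complexify_comp hdiff hψ'
  -- the scalar component as `proj_j (D(ψ^ℂ) m)`
  have hfun : (fun x => ((fderiv ℝ ψ x m j : ℝ) : ℂ)) =
      fun x => (EuclideanSpace.proj j : (EuclideanSpace ℂ (Fin 3)) →L[ℂ] ℂ) (fderiv ℝ (complexify ∘ ψ) x m) := by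
    funext x
    rw [fderiv_complexify_comp_eq hdiff x]
    simp [PiLp.proj_apply, complexify_apply]
  rw [hfun, fourier_clm_comp_apply (EuclideanSpace.proj j : (EuclideanSpace ℂ (Fin 3)) →L[ℂ] ℂ) (hint.apply_continuousLinearMap m),
    ← Real.fourier_continuousLinearMap_apply hint, Real.fourier_fderiv hψ1 hdiffc hint,
    VectorFourier.fourierSMulRight_apply]
  simp only [neg_apply, neg_smul, smul_neg, neg_neg, PiLp.proj_apply]
  rw [PiLp.smul_apply, PiLp.smul_apply, smul_eq_mul, Complex.real_smul, innerSL_apply_apply]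
  ring

/-! ### Physical-space bookkeeping: `⟪f, (f·∇)ψ⟫ = Σᵢⱼ fⱼ fᵢ ∂ᵢψⱼ` -/


/-- `Dψ(x)(v) = Σᵢ vᵢ Dψ(x)(eᵢ)`. [folklore]
[cite: Tao2016AveragedNS, §1.1 (1.3)–(1.5), (1.15) pp. 3–7 (the `H¹⁰_df` mild formulation of the true Navier–Stokes form and its Fourier-side calculus) (source of the NOTION / ARGUMENT this module implements; this declaration is the cell’s own lemma or plumbing, NOT a printed statement)] -/
theorem clm_apply_eq_sum (L : (EuclideanSpace ℝ (Fin 3)) →L[ℝ] (EuclideanSpace ℝ (Fin 3))) (v : (EuclideanSpace ℝ (Fin 3))) : L v = ∑ i, v i • L ((EuclideanSpace.single i (1 : ℝ) : EuclideanSpace ℝ (Fin 3))) := by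
  conv_lhs => rw [← (EuclideanSpace.basisFun (Fin 3) ℝ).sum_repr v]
  rw [map_sum]
  refine Finset.sum_congr rfl fun i _ => ?_
  rw [map_smul, EuclideanSpace.basisFun_repr, EuclideanSpace.basisFun_apply]

/-- `⟪f, Dψ(f)⟫ = Σᵢ Σⱼ fⱼ fᵢ (Dψ eᵢ)ⱼ`. [folklore]
[cite: Tao2016AveragedNS, §1.1 (1.3)–(1.5), (1.15) pp. 3–7 (the `H¹⁰_df` mild formulation of the true Navier–Stokes form and its Fourier-side calculus) (source of the NOTION / ARGUMENT this module implements; this declaration is the cell’s own lemma or plumbing, NOT a printed statement)] -/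
theorem inner_clm_apply_eq_sum (L : (EuclideanSpace ℝ (Fin 3)) →L[ℝ] (EuclideanSpace ℝ (Fin 3))) (v : (EuclideanSpace ℝ (Fin 3))) :
    ⟪v, L v⟫ = ∑ i, ∑ j, v j * v i * L ((EuclideanSpace.single i (1 : ℝ) : EuclideanSpace ℝ (Fin 3))) j := by
  rw [clm_apply_eq_sum L v, inner_sum]
  refine Finset.sum_congr rfl fun i _ => ?_
  rw [inner_smul_right, PiLp.inner_apply, Finset.mul_sum]
  refine Finset.sum_congr rfl fun j _ => ?_
  simp only [RCLike.inner_apply, conj_trivial]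
  ring

/-! ### Fourier-side algebra -/

/-- `Σᵢ Σⱼ Xⱼ Yᵢ (c zᵢ Zⱼ) = c (Y·z) (X·Z)`. [folklore]
[cite: Tao2016AveragedNS, §1.1 (1.3)–(1.5), (1.15) pp. 3–7 (the `H¹⁰_df` mild formulation of the true Navier–Stokes form and its Fourier-side calculus) (source of the NOTION / ARGUMENT this module implements; this declaration is the cell’s own lemma or plumbing, NOT a printed statement)] -/
theorem sum_sum_eq_cdot (X Y Z z : (EuclideanSpace ℂ (Fin 3))) (c : ℂ) :
    ∑ i, ∑ j, X j * Y i * (c * z i * Z j) = c * cdot Y z * cdot X Z := by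
  simp only [cdot, Fin.sum_univ_three]
  ring

/-- `G · (-ξ₁-ξ₂)^ℂ = -(G · ξ₁^ℂ) - G · ξ₂^ℂ`. [folklore]
[cite: Tao2016AveragedNS, §1.1 (1.3)–(1.5), (1.15) pp. 3–7 (the `H¹⁰_df` mild formulation of the true Navier–Stokes form and its Fourier-side calculus) (source of the NOTION / ARGUMENT this module implements; this declaration is the cell’s own lemma or plumbing, NOT a printed statement)] -/
theorem cdot_complexify_neg_sub (X : (EuclideanSpace ℂ (Fin 3))) (ξ₁ ξ₂ : (EuclideanSpace ℝ (Fin 3))) :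
    cdot X (complexify (-ξ₁ - ξ₂)) = -cdot X (complexify ξ₁) - cdot X (complexify ξ₂) := by
  rw [map_sub, map_neg, cdot_sub_right', cdot_neg_right']
where
  /-- local copies of the `cdot` algebra (the tree versions live in heavier files) -/
  cdot_sub_right' (a b c : (EuclideanSpace ℂ (Fin 3))) : cdot a (b - c) = cdot a b - cdot a c := by
    simp only [cdot, PiLp.sub_apply, mul_sub, Finset.sum_sub_distrib]
  cdot_neg_right' (a b : (EuclideanSpace ℂ (Fin 3))) : cdot a (-b) = -cdot a b := by
    simp only [cdot, PiLp.neg_apply, mul_neg, Finset.sum_neg_distrib]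

/-! ### Integrability on frequency space `ℝ³ × ℝ³` -/

/-- The basic dominating function `(‖ξ₁‖ + ‖ξ₂‖ + 1) ‖G ξ₁‖ ‖G ξ₂‖` is integrable on `ℝ³ × ℝ³` when
`G, |ξ|G ∈ L¹`. [folklore]
[cite: Tao2016AveragedNS, §1.1 (1.3)–(1.5), (1.15) pp. 3–7 (the `H¹⁰_df` mild formulation of the true Navier–Stokes form and its Fourier-side calculus) (source of the NOTION / ARGUMENT this module implements; this declaration is the cell’s own lemma or plumbing, NOT a printed statement)] -/
theorem integrable_dominator {G : (EuclideanSpace ℝ (Fin 3)) → (EuclideanSpace ℂ (Fin 3))} (hG : Integrable G)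
    (hGm : Integrable (fun ξ : (EuclideanSpace ℝ (Fin 3)) => ‖ξ‖ * ‖G ξ‖)) :
    Integrable (fun p : (EuclideanSpace ℝ (Fin 3)) × (EuclideanSpace ℝ (Fin 3)) => (‖p.1‖ + ‖p.2‖ + 1) * ‖G p.1‖ * ‖G p.2‖) (volume.prod volume) := by
  have h1 : Integrable (fun p : (EuclideanSpace ℝ (Fin 3)) × (EuclideanSpace ℝ (Fin 3)) => (‖p.1‖ * ‖G p.1‖) * ‖G p.2‖) (volume.prod volume) :=
    hGm.mul_prod hG.norm
  have h2 : Integrable (fun p : (EuclideanSpace ℝ (Fin 3)) × (EuclideanSpace ℝ (Fin 3)) => ‖G p.1‖ * (‖p.2‖ * ‖G p.2‖)) (volume.prod volume) :=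
    hG.norm.mul_prod hGm
  have h3 : Integrable (fun p : (EuclideanSpace ℝ (Fin 3)) × (EuclideanSpace ℝ (Fin 3)) => ‖G p.1‖ * ‖G p.2‖) (volume.prod volume) :=
    hG.norm.mul_prod hG.norm
  refine ((h1.add h2).add h3).congr (Eventually.of_forall fun p => ?_)
  simp only [Pi.add_apply]
  ring

/-- Integrability of a frequency-space integrand dominated by `C (‖ξ₁‖+‖ξ₂‖+1) ‖G ξ₁‖ ‖G ξ₂‖`. [folklore]
[cite: Tao2016AveragedNS, §1.1 (1.3)–(1.5), (1.15) pp. 3–7 (the `H¹⁰_df` mild formulation of the true Navier–Stokes form and its Fourier-side calculus) (source of the NOTION / ARGUMENT this module implements; this declaration is the cell’s own lemma or plumbing, NOT a printed statement)] -/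
theorem integrable_of_dominated {G : (EuclideanSpace ℝ (Fin 3)) → (EuclideanSpace ℂ (Fin 3))} (hG : Integrable G)
    (hGm : Integrable (fun ξ : (EuclideanSpace ℝ (Fin 3)) => ‖ξ‖ * ‖G ξ‖)) {Φ : (EuclideanSpace ℝ (Fin 3)) × (EuclideanSpace ℝ (Fin 3)) → ℂ}
    (hΦm : AEStronglyMeasurable Φ (volume.prod volume)) {C : ℝ}
    (hΦ : ∀ p : (EuclideanSpace ℝ (Fin 3)) × (EuclideanSpace ℝ (Fin 3)), ‖Φ p‖ ≤ C * ((‖p.1‖ + ‖p.2‖ + 1) * ‖G p.1‖ * ‖G p.2‖)) :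
    Integrable Φ (volume.prod volume) :=
  Integrable.mono' ((integrable_dominator hG hGm).const_mul C) hΦm (Eventually.of_forall hΦ)

/-! ### The main identification -/

end Trilinear

end Literature.Analysis.PerpetualPump.PerpetualPumpEulerTypeIGlue

end Part4

/-!
## Part 5 — port of `Summits/NavierStokesRegularity/NavierStokesRegularity/Theorems/PerpetualPumpEulerTypeIGlueCubic.lean` (19 declarations kept)

# Route PerpetualPump · `EulerTypeIGlue` — stub `stub_cubic` (line `Sketch`): Tao's Euler form (1.3)
# is the physical trilinear form

Main result of the preparations in `PerpetualPumpEulerTypeIGlueTrilinearPrep` /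
`PerpetualPumpEulerTypeIGlueTripleProduct`: for a continuous real field `f : ℝ³ → ℝ³` whose
complexified `L²` class `[f^ℂ]` has finite `H¹⁰` norm and is Fourier-divergence-free, and a `C¹` field
`ψ` with `ψ, Dψ ∈ L¹`, `ψ^ℂ ∈ L²`,
`⟨B([f^ℂ],[f^ℂ]), [ψ^ℂ]⟩ = ∫ ⟪f, (f·∇)ψ⟫ dx`,
where `⟨B(·,·),·⟩ = eulerForm` is Tao's Fourier-side form (1.3)–(1.4)
(`Literature/Analysis/FluidPDE/TaoAveragedSobolev.lean`). Proof: `⟪f,(f·∇)ψ⟫ = Σᵢⱼ fⱼ fᵢ ∂ᵢψⱼ`; each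
scalar term is a triple product `∫ a b c` with `a = 𝓕⁻¹(f̂ⱼ)`, `b = 𝓕⁻¹(f̂ᵢ)` a.e. (`f̂ ∈ L¹` for
`H¹⁰` fields) and `c = ∂ᵢψⱼ ∈ L¹`, so `∫ a b c = ∫∫ f̂ⱼ(ξ₁) f̂ᵢ(ξ₂) ĉ(-ξ₁-ξ₂)` (toolkit VI) with
`ĉ(η) = 2πi ηᵢ ψ̂ⱼ(η)`; resumming, `Σᵢⱼ = 2πi (f̂(ξ₂)·ξ₃)(f̂(ξ₁)·ψ̂(ξ₃))`, `ξ₃ = -ξ₁-ξ₂`; the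
divergence-free condition kills `f̂(ξ₂)·ξ₂`, leaving `-2πi ∫∫ (f̂(ξ₂)·ξ₁)(f̂(ξ₁)·ψ̂(ξ₃))`, while
`-πi ∫∫ Λ` is the sum of this integral and its image under the swap `ξ₁ ↔ ξ₂`. (Sign / `2π`
normalisation cross-checked symbolically on Gaussian test triples, kit job j015106.)

## References

* T. Tao, J. Amer. Math. Soc. 29 (2016), arXiv:1402.0290v3, §1.1 (1.3)–(1.4) ("which one can write
  in Fourier space as …"). [Tao2016AveragedNS]
* E. M. Stein, G. Weiss, *Introduction to Fourier Analysis on Euclidean Spaces* (1971), Ch. I,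
  Thm. 1.15 (multiplication formula), Thm. 1.8 (derivatives).
-/

section Part5

open _root_.MeasureTheory _root_.Set _root_.Filter _root_.Topology FourierTransform SchwartzMap
open scoped _root_.ENNReal _root_.NNReal FourierTransform RealInnerProductSpace _root_.ContDiff

namespace Literature.Analysis.PerpetualPump.PerpetualPumpEulerTypeIGlue

section Cubic

open Literature.Analysis.FluidPDE Literature.Analysis.FluidPDE.Tao2016
open Literature.Analysis.FunctionSpaces (eFourierSobolevNorm)
open Literature.Analysis.FunctionSpaces.EuclideanSpace (complexify complexify_apply norm_complexify
  continuous_complexify)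


/-! ### Small algebra -/

/-- `Λ` split into its two summands. [cite: Tao2016AveragedNS, (1.4)] -/
theorem Λ_eq_add (ξ₁ ξ₂ : (EuclideanSpace ℝ (Fin 3))) (X₁ X₂ X₃ : (EuclideanSpace ℂ (Fin 3))) :
    Λ ξ₁ ξ₂ X₁ X₂ X₃ = cdot X₁ (complexify ξ₂) * cdot X₂ X₃ + cdot X₂ (complexify ξ₁) * cdot X₁ X₃ :=
  rfl

/-! ### The physical side: `⟪f, (f·∇)ψ⟫` as a double sum of scalar triple products -/

variable {f ψ : (EuclideanSpace ℝ (Fin 3)) → (EuclideanSpace ℝ (Fin 3))}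

/-- `⟪f, (f·∇)ψ⟫(x) = Σᵢⱼ fⱼ fᵢ ∂ᵢψⱼ`, complexified. [folklore]
[cite: Tao2016AveragedNS, §1.1 (1.3)–(1.5), (1.15) pp. 3–7 (the `H¹⁰_df` mild formulation of the true Navier–Stokes form and its Fourier-side calculus) (source of the NOTION / ARGUMENT this module implements; this declaration is the cell’s own lemma or plumbing, NOT a printed statement)] -/
theorem ofReal_inner_convect_eq_sum (x : (EuclideanSpace ℝ (Fin 3))) :
    (((⟪f x, convect f ψ x⟫ : ℝ)) : ℂ) =
      ∑ i, ∑ j, ((f x j : ℝ) : ℂ) * ((f x i : ℝ) : ℂ) * ((fderiv ℝ ψ x ((EuclideanSpace.single i (1 : ℝ) : EuclideanSpace ℝ (Fin 3))) j : ℝ) : ℂ) := by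
  rw [convect_apply, inner_clm_apply_eq_sum]
  push_cast
  rfl

/-- The component `x ↦ ∂ᵢψⱼ(x)` (complexified) is integrable when `Dψ` is. [folklore]
[cite: Tao2016AveragedNS, §1.1 (1.3)–(1.5), (1.15) pp. 3–7 (the `H¹⁰_df` mild formulation of the true Navier–Stokes form and its Fourier-side calculus) (source of the NOTION / ARGUMENT this module implements; this declaration is the cell’s own lemma or plumbing, NOT a printed statement)] -/
theorem integrable_fderiv_component (hψ' : Integrable (fderiv ℝ ψ)) (i j : Fin 3) :
    Integrable (fun x => ((fderiv ℝ ψ x ((EuclideanSpace.single i (1 : ℝ) : EuclideanSpace ℝ (Fin 3))) j : ℝ) : ℂ)) := by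
  have h1 : Integrable (fun x => fderiv ℝ ψ x ((EuclideanSpace.single i (1 : ℝ) : EuclideanSpace ℝ (Fin 3)))) := hψ'.apply_continuousLinearMap _
  have h2 : Integrable (fun x => (fderiv ℝ ψ x ((EuclideanSpace.single i (1 : ℝ) : EuclideanSpace ℝ (Fin 3)))) j) :=
    (EuclideanSpace.proj j : (EuclideanSpace ℝ (Fin 3)) →L[ℝ] ℝ).integrable_comp h1
  exact Complex.ofRealCLM.integrable_comp h2

/-- A coordinate of a continuous field is continuous (complexified). [folklore]
[cite: Tao2016AveragedNS, §1.1 (1.3)–(1.5), (1.15) pp. 3–7 (the `H¹⁰_df` mild formulation of the true Navier–Stokes form and its Fourier-side calculus) (source of the NOTION / ARGUMENT this module implements; this declaration is the cell’s own lemma or plumbing, NOT a printed statement)] -/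
theorem continuous_ofReal_apply (hf : Continuous f) (j : Fin 3) :
    Continuous (fun x => ((f x j : ℝ) : ℂ)) :=
  Complex.continuous_ofReal.comp ((EuclideanSpace.proj j : (EuclideanSpace ℝ (Fin 3)) →L[ℝ] ℝ).continuous.comp hf)

/-- The scalar triple products `fⱼ fᵢ ∂ᵢψⱼ` are integrable: `fⱼ`, `fᵢ` agree a.e. with inverse
Fourier integrals of integrable functions, hence are a.e. bounded, and `∂ᵢψⱼ ∈ L¹`. [folklore]
[cite: Tao2016AveragedNS, §1.1 (1.3)–(1.5), (1.15) pp. 3–7 (the `H¹⁰_df` mild formulation of the true Navier–Stokes form and its Fourier-side calculus) (source of the NOTION / ARGUMENT this module implements; this declaration is the cell’s own lemma or plumbing, NOT a printed statement)] -/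
theorem integrable_triple (hf : Continuous f) (h2 : MemLp (complexify ∘ f) 2 (volume : Measure (EuclideanSpace ℝ (Fin 3))))
    (hH : eFourierSobolevNorm 10 (h2.toLp _) < ⊤) (hψ' : Integrable (fderiv ℝ ψ)) (i j : Fin 3) :
    Integrable (fun x => ((f x j : ℝ) : ℂ) * ((f x i : ℝ) : ℂ) * ((fderiv ℝ ψ x ((EuclideanSpace.single i (1 : ℝ) : EuclideanSpace ℝ (Fin 3))) j : ℝ) : ℂ)) := by
  set F : (EuclideanSpace ℝ (Fin 3)) → (EuclideanSpace ℂ (Fin 3)) := fourierFn (h2.toLp _) with hF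
  have hFi : Integrable F := (integrable_fourierFn_and_moment hH).1
  have hA : Integrable (fun ξ => F ξ j) := integrable_apply_of_integrable hFi j
  have hB : Integrable (fun ξ => F ξ i) := integrable_apply_of_integrable hFi i
  have ha := component_ae_eq_fourierInv h2 hH j
  have hb := component_ae_eq_fourierInv h2 hH i
  have hc := integrable_fderiv_component hψ' i j
  set KA : ℝ := ∫ ξ, ‖F ξ j‖ with hKA
  set KB : ℝ := ∫ ξ, ‖F ξ i‖ with hKB
  refine Integrable.mono' (hc.norm.const_mul (KA * KB))
    (((continuous_ofReal_apply hf j).mul (continuous_ofReal_apply hf i)).aestronglyMeasurable.mul hc.1) ?_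
  filter_upwards [ha, hb] with x hx hy
  rw [norm_mul, norm_mul, hx, hy]
  have h1 := Literature.Analysis.FunctionSpaces.SobolevEmbeddingHalf.norm_fourierIntegralInv_le_integral_norm
    (fun ξ => F ξ j) x
  have h2' := Literature.Analysis.FunctionSpaces.SobolevEmbeddingHalf.norm_fourierIntegralInv_le_integral_norm
    (fun ξ => F ξ i) x
  have hKA0 : 0 ≤ KA := integral_nonneg fun _ => norm_nonneg _
  calc ‖𝓕⁻ (fun ξ => F ξ j) x‖ * ‖𝓕⁻ (fun ξ => F ξ i) x‖ * ‖((fderiv ℝ ψ x ((EuclideanSpace.single i (1 : ℝ) : EuclideanSpace ℝ (Fin 3))) j : ℝ) : ℂ)‖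
      ≤ KA * KB * ‖((fderiv ℝ ψ x ((EuclideanSpace.single i (1 : ℝ) : EuclideanSpace ℝ (Fin 3))) j : ℝ) : ℂ)‖ := by
        refine mul_le_mul_of_nonneg_right (mul_le_mul h1 h2' (norm_nonneg _) hKA0) (norm_nonneg _)
    _ = KA * KB * ‖((fderiv ℝ ψ x ((EuclideanSpace.single i (1 : ℝ) : EuclideanSpace ℝ (Fin 3))) j : ℝ) : ℂ)‖ := rfl

/-! ### The frequency side: integrability on `ℝ³ × ℝ³` -/

/-- The Fourier integral of the complexified test field is continuous. [folklore]
[cite: Tao2016AveragedNS, §1.1 (1.3)–(1.5), (1.15) pp. 3–7 (the `H¹⁰_df` mild formulation of the true Navier–Stokes form and its Fourier-side calculus) (source of the NOTION / ARGUMENT this module implements; this declaration is the cell’s own lemma or plumbing, NOT a printed statement)] -/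
theorem continuous_fourier_complexify (hψ1c : Integrable (complexify ∘ ψ)) :
    Continuous (𝓕 (complexify ∘ ψ)) :=
  VectorFourier.fourierIntegral_continuous Real.continuous_fourierChar continuous_inner hψ1c

/-- The Fourier integral is bounded by the `L¹` norm. [folklore]
[cite: Tao2016AveragedNS, §1.1 (1.3)–(1.5), (1.15) pp. 3–7 (the `H¹⁰_df` mild formulation of the true Navier–Stokes form and its Fourier-side calculus) (source of the NOTION / ARGUMENT this module implements; this declaration is the cell’s own lemma or plumbing, NOT a printed statement)] -/
theorem norm_fourier_complexify_le (ψ : (EuclideanSpace ℝ (Fin 3)) → (EuclideanSpace ℝ (Fin 3))) (η : (EuclideanSpace ℝ (Fin 3))) :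
    ‖𝓕 (complexify ∘ ψ) η‖ ≤ ∫ x, ‖(complexify ∘ ψ) x‖ :=
  VectorFourier.norm_fourierIntegral_le_integral_norm 𝐞 volume (innerₗ (EuclideanSpace ℝ (Fin 3))) _ η

/-- Measurability of `p ↦ F p.1` on the product space. [folklore]
[cite: Tao2016AveragedNS, §1.1 (1.3)–(1.5), (1.15) pp. 3–7 (the `H¹⁰_df` mild formulation of the true Navier–Stokes form and its Fourier-side calculus) (source of the NOTION / ARGUMENT this module implements; this declaration is the cell’s own lemma or plumbing, NOT a printed statement)] -/
theorem aestronglyMeasurable_comp_fst' {F : (EuclideanSpace ℝ (Fin 3)) → (EuclideanSpace ℂ (Fin 3))} (hF : AEStronglyMeasurable F volume) :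
    AEStronglyMeasurable (fun p : (EuclideanSpace ℝ (Fin 3)) × (EuclideanSpace ℝ (Fin 3)) => F p.1) ((volume : Measure (EuclideanSpace ℝ (Fin 3))).prod volume) :=
  hF.comp_quasiMeasurePreserving Measure.quasiMeasurePreserving_fst

/-- Measurability of `p ↦ F p.2` on the product space. [folklore]
[cite: Tao2016AveragedNS, §1.1 (1.3)–(1.5), (1.15) pp. 3–7 (the `H¹⁰_df` mild formulation of the true Navier–Stokes form and its Fourier-side calculus) (source of the NOTION / ARGUMENT this module implements; this declaration is the cell’s own lemma or plumbing, NOT a printed statement)] -/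
theorem aestronglyMeasurable_comp_snd' {F : (EuclideanSpace ℝ (Fin 3)) → (EuclideanSpace ℂ (Fin 3))} (hF : AEStronglyMeasurable F volume) :
    AEStronglyMeasurable (fun p : (EuclideanSpace ℝ (Fin 3)) × (EuclideanSpace ℝ (Fin 3)) => F p.2) ((volume : Measure (EuclideanSpace ℝ (Fin 3))).prod volume) :=
  hF.comp_quasiMeasurePreserving Measure.quasiMeasurePreserving_snd

/-- Measurability of `p ↦ A(p) · B(p)` for measurable `A`, `B`. [folklore]
[cite: Tao2016AveragedNS, §1.1 (1.3)–(1.5), (1.15) pp. 3–7 (the `H¹⁰_df` mild formulation of the true Navier–Stokes form and its Fourier-side calculus) (source of the NOTION / ARGUMENT this module implements; this declaration is the cell’s own lemma or plumbing, NOT a printed statement)] -/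
theorem aestronglyMeasurable_cdot_comp {μ : Measure ((EuclideanSpace ℝ (Fin 3)) × (EuclideanSpace ℝ (Fin 3)))} {A B : (EuclideanSpace ℝ (Fin 3)) × (EuclideanSpace ℝ (Fin 3)) → (EuclideanSpace ℂ (Fin 3))}
    (hA : AEStronglyMeasurable A μ) (hB : AEStronglyMeasurable B μ) :
    AEStronglyMeasurable (fun p => cdot (A p) (B p)) μ := by
  have h : (fun p => cdot (A p) (B p)) = (fun q : (EuclideanSpace ℂ (Fin 3)) × (EuclideanSpace ℂ (Fin 3)) => cdot q.1 q.2) ∘ fun p => (A p, B p) := rfl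
  rw [h]
  exact continuous_cdot.comp_aestronglyMeasurable (hA.prodMk hB)

/-- `‖-ξ₁-ξ₂‖ ≤ ‖ξ₁‖ + ‖ξ₂‖ + 1`. [folklore]
[cite: Tao2016AveragedNS, §1.1 (1.3)–(1.5), (1.15) pp. 3–7 (the `H¹⁰_df` mild formulation of the true Navier–Stokes form and its Fourier-side calculus) (source of the NOTION / ARGUMENT this module implements; this declaration is the cell’s own lemma or plumbing, NOT a printed statement)] -/
theorem norm_neg_sub_le_add_one (ξ₁ ξ₂ : (EuclideanSpace ℝ (Fin 3))) : ‖-ξ₁ - ξ₂‖ ≤ ‖ξ₁‖ + ‖ξ₂‖ + 1 := by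
  calc ‖-ξ₁ - ξ₂‖ ≤ ‖-ξ₁‖ + ‖ξ₂‖ := norm_sub_le _ _
    _ = ‖ξ₁‖ + ‖ξ₂‖ := by rw [norm_neg]
    _ ≤ ‖ξ₁‖ + ‖ξ₂‖ + 1 := le_add_of_nonneg_right zero_le_one

/-- **Integrability of the `(i,j)` frequency-side term** `f̂ⱼ(ξ₁) f̂ᵢ(ξ₂) (2πi ξ₃ᵢ Ĝⱼ(ξ₃))`,
`ξ₃ = -ξ₁-ξ₂`, for `f̂ ∈ L¹` with first moment and `Ĝ` continuous and bounded. [folklore]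
[cite: Tao2016AveragedNS, §1.1 (1.3)–(1.5), (1.15) pp. 3–7 (the `H¹⁰_df` mild formulation of the true Navier–Stokes form and its Fourier-side calculus) (source of the NOTION / ARGUMENT this module implements; this declaration is the cell’s own lemma or plumbing, NOT a printed statement)] -/
theorem integrable_freq_term {F : (EuclideanSpace ℝ (Fin 3)) → (EuclideanSpace ℂ (Fin 3))} (hFi : Integrable F)
    (hFm : Integrable (fun ξ : (EuclideanSpace ℝ (Fin 3)) => ‖ξ‖ * ‖F ξ‖)) {G : (EuclideanSpace ℝ (Fin 3)) → (EuclideanSpace ℂ (Fin 3))} (hG : Continuous G) {KG : ℝ}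
    (hGb : ∀ η, ‖G η‖ ≤ KG) (i j : Fin 3) :
    Integrable (fun p : (EuclideanSpace ℝ (Fin 3)) × (EuclideanSpace ℝ (Fin 3)) => F p.1 j * F p.2 i *
      ((2 * Real.pi * Complex.I) * (((-p.1 - p.2) i : ℝ) : ℂ) * G (-p.1 - p.2) j))
      ((volume : Measure (EuclideanSpace ℝ (Fin 3))).prod volume) := by
  have hKG : 0 ≤ KG := (norm_nonneg _).trans (hGb 0)
  have hq : Continuous fun p : (EuclideanSpace ℝ (Fin 3)) × (EuclideanSpace ℝ (Fin 3)) => -p.1 - p.2 := by fun_prop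
  refine integrable_of_dominated hFi hFm ?_ (C := 2 * Real.pi * KG) fun p => ?_
  · refine AEStronglyMeasurable.mul (AEStronglyMeasurable.mul ?_ ?_) ?_
    · exact (EuclideanSpace.proj j : (EuclideanSpace ℂ (Fin 3)) →L[ℂ] ℂ).continuous.comp_aestronglyMeasurable
        (aestronglyMeasurable_comp_fst' hFi.1)
    · exact (EuclideanSpace.proj i : (EuclideanSpace ℂ (Fin 3)) →L[ℂ] ℂ).continuous.comp_aestronglyMeasurable
        (aestronglyMeasurable_comp_snd' hFi.1)
    · refine Continuous.aestronglyMeasurable ?_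
      refine Continuous.mul (continuous_const.mul ?_) ?_
      · exact Complex.continuous_ofReal.comp ((EuclideanSpace.proj i : (EuclideanSpace ℝ (Fin 3)) →L[ℝ] ℝ).continuous.comp hq)
      · exact (EuclideanSpace.proj j : (EuclideanSpace ℂ (Fin 3)) →L[ℂ] ℂ).continuous.comp (hG.comp hq)
  · have h1 : ‖F p.1 j‖ ≤ ‖F p.1‖ := PiLp.norm_apply_le _ _
    have h2 : ‖F p.2 i‖ ≤ ‖F p.2‖ := PiLp.norm_apply_le _ _
    have h3 : ‖(((-p.1 - p.2) i : ℝ) : ℂ)‖ ≤ ‖p.1‖ + ‖p.2‖ + 1 := by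
      rw [Complex.norm_real]
      exact (PiLp.norm_apply_le (-p.1 - p.2) i).trans (norm_neg_sub_le_add_one _ _)
    have h4 : ‖G (-p.1 - p.2) j‖ ≤ KG := (PiLp.norm_apply_le _ _).trans (hGb _)
    have h2π : ‖(2 * Real.pi * Complex.I : ℂ)‖ = 2 * Real.pi := by
      rw [norm_mul, norm_mul, Complex.norm_I, mul_one, Complex.norm_ofNat, Complex.norm_real,
        Real.norm_of_nonneg Real.pi_pos.le]
    rw [norm_mul, norm_mul, norm_mul, norm_mul, h2π]
    have hp0 : 0 ≤ ‖p.1‖ + ‖p.2‖ + 1 := by positivity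
    calc ‖F p.1 j‖ * ‖F p.2 i‖ * (2 * Real.pi * ‖(((-p.1 - p.2) i : ℝ) : ℂ)‖ * ‖G (-p.1 - p.2) j‖)
        ≤ ‖F p.1‖ * ‖F p.2‖ * (2 * Real.pi * (‖p.1‖ + ‖p.2‖ + 1) * KG) := by
          refine mul_le_mul (mul_le_mul h1 h2 (norm_nonneg _) (norm_nonneg _)) ?_ (by positivity)
            (by positivity)
          exact mul_le_mul (mul_le_mul_of_nonneg_left h3 (by positivity)) h4 (norm_nonneg _)
            (by positivity)
      _ = 2 * Real.pi * KG * ((‖p.1‖ + ‖p.2‖ + 1) * ‖F p.1‖ * ‖F p.2‖) := by ring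

/-- **Integrability of the symmetrised term** `(f̂(ξ₂)·ξ₁)(f̂(ξ₁)·Ĝ(ξ₃))`, `ξ₃ = -ξ₁-ξ₂`. [folklore]
[cite: Tao2016AveragedNS, §1.1 (1.3)–(1.5), (1.15) pp. 3–7 (the `H¹⁰_df` mild formulation of the true Navier–Stokes form and its Fourier-side calculus) (source of the NOTION / ARGUMENT this module implements; this declaration is the cell’s own lemma or plumbing, NOT a printed statement)] -/
theorem integrable_Tb {F : (EuclideanSpace ℝ (Fin 3)) → (EuclideanSpace ℂ (Fin 3))} (hFi : Integrable F)
    (hFm : Integrable (fun ξ : (EuclideanSpace ℝ (Fin 3)) => ‖ξ‖ * ‖F ξ‖)) {G : (EuclideanSpace ℝ (Fin 3)) → (EuclideanSpace ℂ (Fin 3))} (hG : Continuous G) {KG : ℝ}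
    (hGb : ∀ η, ‖G η‖ ≤ KG) :
    Integrable (fun p : (EuclideanSpace ℝ (Fin 3)) × (EuclideanSpace ℝ (Fin 3)) => cdot (F p.2) (complexify p.1) * cdot (F p.1) (G (-p.1 - p.2)))
      ((volume : Measure (EuclideanSpace ℝ (Fin 3))).prod volume) := by
  have hKG : 0 ≤ KG := (norm_nonneg _).trans (hGb 0)
  have hq : Continuous fun p : (EuclideanSpace ℝ (Fin 3)) × (EuclideanSpace ℝ (Fin 3)) => -p.1 - p.2 := by fun_prop
  refine integrable_of_dominated hFi hFm ?_ (C := KG) fun p => ?_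
  · exact (aestronglyMeasurable_cdot_comp (aestronglyMeasurable_comp_snd' hFi.1)
      (continuous_complexify.comp continuous_fst).aestronglyMeasurable).mul
      (aestronglyMeasurable_cdot_comp (aestronglyMeasurable_comp_fst' hFi.1)
      ((hG.comp hq).aestronglyMeasurable))
  · rw [norm_mul]
    have h1 : ‖cdot (F p.2) (complexify p.1)‖ ≤ ‖F p.2‖ * ‖p.1‖ := by
      simpa [norm_complexify] using norm_cdot_le (F p.2) (complexify p.1)
    have h2 : ‖cdot (F p.1) (G (-p.1 - p.2))‖ ≤ ‖F p.1‖ * KG :=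
      (norm_cdot_le _ _).trans (mul_le_mul_of_nonneg_left (hGb _) (norm_nonneg _))
    calc ‖cdot (F p.2) (complexify p.1)‖ * ‖cdot (F p.1) (G (-p.1 - p.2))‖
        ≤ ‖F p.2‖ * ‖p.1‖ * (‖F p.1‖ * KG) :=
          mul_le_mul h1 h2 (norm_nonneg _) (by positivity)
      _ ≤ ‖F p.2‖ * (‖p.1‖ + ‖p.2‖ + 1) * (‖F p.1‖ * KG) := by
          gcongr
          linarith [norm_nonneg p.2]
      _ = KG * ((‖p.1‖ + ‖p.2‖ + 1) * ‖F p.1‖ * ‖F p.2‖) := by ring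

/-- **Integrability of the swapped term** `(f̂(ξ₁)·ξ₂)(f̂(ξ₂)·Ĝ(ξ₃))`, `ξ₃ = -ξ₁-ξ₂`. [folklore]
[cite: Tao2016AveragedNS, §1.1 (1.3)–(1.5), (1.15) pp. 3–7 (the `H¹⁰_df` mild formulation of the true Navier–Stokes form and its Fourier-side calculus) (source of the NOTION / ARGUMENT this module implements; this declaration is the cell’s own lemma or plumbing, NOT a printed statement)] -/
theorem integrable_Ta {F : (EuclideanSpace ℝ (Fin 3)) → (EuclideanSpace ℂ (Fin 3))} (hFi : Integrable F)
    (hFm : Integrable (fun ξ : (EuclideanSpace ℝ (Fin 3)) => ‖ξ‖ * ‖F ξ‖)) {G : (EuclideanSpace ℝ (Fin 3)) → (EuclideanSpace ℂ (Fin 3))} (hG : Continuous G) {KG : ℝ}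
    (hGb : ∀ η, ‖G η‖ ≤ KG) :
    Integrable (fun p : (EuclideanSpace ℝ (Fin 3)) × (EuclideanSpace ℝ (Fin 3)) => cdot (F p.1) (complexify p.2) * cdot (F p.2) (G (-p.1 - p.2)))
      ((volume : Measure (EuclideanSpace ℝ (Fin 3))).prod volume) := by
  have hKG : 0 ≤ KG := (norm_nonneg _).trans (hGb 0)
  have hq : Continuous fun p : (EuclideanSpace ℝ (Fin 3)) × (EuclideanSpace ℝ (Fin 3)) => -p.1 - p.2 := by fun_prop
  refine integrable_of_dominated hFi hFm ?_ (C := KG) fun p => ?_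
  · exact (aestronglyMeasurable_cdot_comp (aestronglyMeasurable_comp_fst' hFi.1)
      (continuous_complexify.comp continuous_snd).aestronglyMeasurable).mul
      (aestronglyMeasurable_cdot_comp (aestronglyMeasurable_comp_snd' hFi.1)
      ((hG.comp hq).aestronglyMeasurable))
  · rw [norm_mul]
    have h1 : ‖cdot (F p.1) (complexify p.2)‖ ≤ ‖F p.1‖ * ‖p.2‖ := by
      simpa [norm_complexify] using norm_cdot_le (F p.1) (complexify p.2)
    have h2 : ‖cdot (F p.2) (G (-p.1 - p.2))‖ ≤ ‖F p.2‖ * KG :=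
      (norm_cdot_le _ _).trans (mul_le_mul_of_nonneg_left (hGb _) (norm_nonneg _))
    calc ‖cdot (F p.1) (complexify p.2)‖ * ‖cdot (F p.2) (G (-p.1 - p.2))‖
        ≤ ‖F p.1‖ * ‖p.2‖ * (‖F p.2‖ * KG) :=
          mul_le_mul h1 h2 (norm_nonneg _) (by positivity)
      _ ≤ ‖F p.1‖ * (‖p.1‖ + ‖p.2‖ + 1) * (‖F p.2‖ * KG) := by
          gcongr
          linarith [norm_nonneg p.1]
      _ = KG * ((‖p.1‖ + ‖p.2‖ + 1) * ‖F p.1‖ * ‖F p.2‖) := by ring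

/-- The swap `ξ₁ ↔ ξ₂` exchanges the two summands of `Λ`: their integrals agree. [folklore]
[cite: Tao2016AveragedNS, §1.1 (1.3)–(1.5), (1.15) pp. 3–7 (the `H¹⁰_df` mild formulation of the true Navier–Stokes form and its Fourier-side calculus) (source of the NOTION / ARGUMENT this module implements; this declaration is the cell’s own lemma or plumbing, NOT a printed statement)] -/
theorem integral_Ta_eq_integral_Tb (F G : (EuclideanSpace ℝ (Fin 3)) → (EuclideanSpace ℂ (Fin 3))) :
    ∫ p, cdot (F p.1) (complexify p.2) * cdot (F p.2) (G (-p.1 - p.2)) ∂((volume : Measure (EuclideanSpace ℝ (Fin 3))).prod volume) =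
      ∫ p, cdot (F p.2) (complexify p.1) * cdot (F p.1) (G (-p.1 - p.2)) ∂((volume : Measure (EuclideanSpace ℝ (Fin 3))).prod volume) := by
  have h := integral_prod_swap (μ := (volume : Measure (EuclideanSpace ℝ (Fin 3)))) (ν := (volume : Measure (EuclideanSpace ℝ (Fin 3))))
    (fun p : (EuclideanSpace ℝ (Fin 3)) × (EuclideanSpace ℝ (Fin 3)) => cdot (F p.2) (complexify p.1) * cdot (F p.1) (G (-p.1 - p.2)))
  rw [← h]
  refine integral_congr_ae (Eventually.of_forall fun p => ?_)
  simp only [Prod.fst_swap, Prod.snd_swap]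
  congr 3
  abel

/-- `Σᵢⱼ ∫ Φᵢⱼ = ∫ Σᵢⱼ Φᵢⱼ` for finitely many integrable functions. [folklore]
[cite: Tao2016AveragedNS, §1.1 (1.3)–(1.5), (1.15) pp. 3–7 (the `H¹⁰_df` mild formulation of the true Navier–Stokes form and its Fourier-side calculus) (source of the NOTION / ARGUMENT this module implements; this declaration is the cell’s own lemma or plumbing, NOT a printed statement)] -/
theorem sum_sum_integral_eq {X : Type*} [MeasurableSpace X] {μ : Measure X}
    (Φ : Fin 3 → Fin 3 → X → ℂ) (h : ∀ i j, Integrable (Φ i j) μ) :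
    ∑ i, ∑ j, ∫ x, Φ i j x ∂μ = ∫ x, ∑ i, ∑ j, Φ i j x ∂μ := by
  rw [integral_finsetSum _ (fun i _ => integrable_finsetSum _ (fun j _ => h i j))]
  refine Finset.sum_congr rfl fun i _ => ?_
  rw [integral_finsetSum _ (fun j _ => h i j)]

/-! ### The main identification -/

/-- `⟪η, eᵢ⟫ = ηᵢ`. [folklore]
[cite: Tao2016AveragedNS, §1.1 (1.3)–(1.5), (1.15) pp. 3–7 (the `H¹⁰_df` mild formulation of the true Navier–Stokes form and its Fourier-side calculus) (source of the NOTION / ARGUMENT this module implements; this declaration is the cell’s own lemma or plumbing, NOT a printed statement)] -/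
theorem inner_single_one_right (η : (EuclideanSpace ℝ (Fin 3))) (i : Fin 3) : ⟪η, (EuclideanSpace.single i (1 : ℝ) : EuclideanSpace ℝ (Fin 3))⟫ = η i := by
  rw [EuclideanSpace.inner_single_right]
  simp

/-- The divergence-free condition in the second frequency variable, on the product space:
`f̂(ξ₂) · ξ₂ = 0` for a.e. `(ξ₁, ξ₂)`. [cite: Tao2016AveragedNS, §1.1 p. 3] -/
theorem ae_cdot_snd_eq_zero {u : L2C} (hdf : IsFourierDivFree u) :
    ∀ᵐ p : (EuclideanSpace ℝ (Fin 3)) × (EuclideanSpace ℝ (Fin 3)) ∂((volume : Measure (EuclideanSpace ℝ (Fin 3))).prod volume), cdot (fourierFn u p.2) (complexify p.2) = 0 := by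
  have h := (Measure.quasiMeasurePreserving_snd (μ := (volume : Measure (EuclideanSpace ℝ (Fin 3))))
    (ν := (volume : Measure (EuclideanSpace ℝ (Fin 3))))).ae hdf
  filter_upwards [h] with p hp
  rw [cdot_comm']
  exact hp

/-- **S1 — the cubic Plancherel identity** (Tao 2016, (1.3)–(1.4) versus the physical trilinear
form): for a continuous real field `f` whose complexified `L²` class is in `H¹⁰` and
Fourier-divergence-free, and a `C¹` field `ψ` with `ψ, Dψ ∈ L¹`, `ψ^ℂ ∈ L²`,
`⟨B([f^ℂ],[f^ℂ]), [ψ^ℂ]⟩ = ∫ ⟪f, (f·∇)ψ⟫`. [cite: Tao2016AveragedNS, §1.1 (1.3)-(1.4)] -/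
theorem stub_cubic {f ψ : (EuclideanSpace ℝ (Fin 3)) → (EuclideanSpace ℝ (Fin 3))} (hf : Continuous f)
    (h2 : MemLp (complexify ∘ f) 2 (volume : Measure (EuclideanSpace ℝ (Fin 3))))
    (hH : eFourierSobolevNorm 10 (h2.toLp _) < ⊤) (hdf : IsFourierDivFree (h2.toLp _))
    (hψ : ContDiff ℝ 1 ψ) (hψ1 : Integrable ψ) (hψ' : Integrable (fderiv ℝ ψ))
    (hψ2 : MemLp (complexify ∘ ψ) 2 (volume : Measure (EuclideanSpace ℝ (Fin 3)))) :
    eulerForm (h2.toLp _) (h2.toLp _) (hψ2.toLp _) = ((∫ x, ⟪f x, convect f ψ x⟫ : ℝ) : ℂ) := by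
  -- the Fourier data
  set F : (EuclideanSpace ℝ (Fin 3)) → (EuclideanSpace ℂ (Fin 3)) := fourierFn (h2.toLp _) with hF
  have hFi : Integrable F := (integrable_fourierFn_and_moment hH).1
  have hFm : Integrable (fun ξ : (EuclideanSpace ℝ (Fin 3)) => ‖ξ‖ * ‖F ξ‖) := (integrable_fourierFn_and_moment hH).2
  have hψ1c : Integrable (complexify ∘ ψ) := complexify.toContinuousLinearMap.integrable_comp hψ1
  set G : (EuclideanSpace ℝ (Fin 3)) → (EuclideanSpace ℂ (Fin 3)) := 𝓕 (complexify ∘ ψ) with hG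
  have hGc : Continuous G := continuous_fourier_complexify hψ1c
  have hGb : ∀ η, ‖G η‖ ≤ ∫ x, ‖(complexify ∘ ψ) x‖ := fun η => norm_fourier_complexify_le ψ η
  have hGae : fourierFn (hψ2.toLp _) =ᵐ[volume] G :=
    Literature.Analysis.FunctionSpaces.fourier_toLp_ae_eq_fourierIntegral hψ1c hψ2
  -- the two product-space terms
  set Ta : (EuclideanSpace ℝ (Fin 3)) × (EuclideanSpace ℝ (Fin 3)) → ℂ := fun p => cdot (F p.1) (complexify p.2) * cdot (F p.2) (G (-p.1 - p.2))
    with hTa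
  set Tb : (EuclideanSpace ℝ (Fin 3)) × (EuclideanSpace ℝ (Fin 3)) → ℂ := fun p => cdot (F p.2) (complexify p.1) * cdot (F p.1) (G (-p.1 - p.2))
    with hTb
  have hTai : Integrable Ta ((volume : Measure (EuclideanSpace ℝ (Fin 3))).prod volume) := integrable_Ta hFi hFm hGc hGb
  have hTbi : Integrable Tb ((volume : Measure (EuclideanSpace ℝ (Fin 3))).prod volume) := integrable_Tb hFi hFm hGc hGb
  -- LHS `= -πi (∫ Ta + ∫ Tb) = -2πi ∫ Tb`
  have hL : eulerForm (h2.toLp _) (h2.toLp _) (hψ2.toLp _) =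
      -(2 * Real.pi * Complex.I) * ∫ p, Tb p ∂((volume : Measure (EuclideanSpace ℝ (Fin 3))).prod volume) := by
    unfold eulerForm
    rw [Measure.volume_eq_prod]
    have hae : (fun p : (EuclideanSpace ℝ (Fin 3)) × (EuclideanSpace ℝ (Fin 3)) =>
        Λ p.1 p.2 (F p.1) (F p.2) (fourierFn (hψ2.toLp _) (-p.1 - p.2))) =ᵐ[(volume : Measure (EuclideanSpace ℝ (Fin 3))).prod volume]
        fun p => Ta p + Tb p := by
      filter_upwards [quasiMeasurePreserving_neg_fst_sub_snd.ae_eq hGae] with p hp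
      simp only [Function.comp_apply] at hp
      rw [hp]
      exact Λ_eq_add _ _ _ _ _
    rw [integral_congr_ae hae, integral_add hTai hTbi, integral_Ta_eq_integral_Tb F G]
    ring
  -- RHS, step 1: the double sum of scalar triple products
  have hR1 : ((∫ x, ⟪f x, convect f ψ x⟫ : ℝ) : ℂ) =
      ∑ i, ∑ j, ∫ x, ((f x j : ℝ) : ℂ) * ((f x i : ℝ) : ℂ) * ((fderiv ℝ ψ x ((EuclideanSpace.single i (1 : ℝ) : EuclideanSpace ℝ (Fin 3))) j : ℝ) : ℂ) := by
    rw [← integral_complex_ofReal]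
    simp_rw [ofReal_inner_convect_eq_sum]
    exact (sum_sum_integral_eq _ (fun i j => integrable_triple hf h2 hH hψ' i j)).symm
  -- RHS, step 2: each triple product on the Fourier side
  have hR2 : ∀ i j : Fin 3,
      ∫ x, ((f x j : ℝ) : ℂ) * ((f x i : ℝ) : ℂ) * ((fderiv ℝ ψ x ((EuclideanSpace.single i (1 : ℝ) : EuclideanSpace ℝ (Fin 3))) j : ℝ) : ℂ) =
        ∫ p, F p.1 j * F p.2 i * ((2 * Real.pi * Complex.I) * (((-p.1 - p.2) i : ℝ) : ℂ) *
          G (-p.1 - p.2) j) ∂((volume : Measure (EuclideanSpace ℝ (Fin 3))).prod volume) := by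
    intro i j
    rw [integral_mul_mul_eq_integral_prod (integrable_apply_of_integrable hFi j)
      (integrable_apply_of_integrable hFi i) (integrable_fderiv_component hψ' i j)
      (component_ae_eq_fourierInv h2 hH j) (component_ae_eq_fourierInv h2 hH i), Measure.volume_eq_prod]
    refine integral_congr_ae (Eventually.of_forall fun p => ?_)
    dsimp only
    rw [fourier_component_fderiv hψ hψ1c hψ' ((EuclideanSpace.single i (1 : ℝ) : EuclideanSpace ℝ (Fin 3))) (-p.1 - p.2) j, inner_single_one_right]
  -- RHS, step 3: resum inside the integral
  have hR3 : ∑ i, ∑ j, ∫ p, F p.1 j * F p.2 i * ((2 * Real.pi * Complex.I) * (((-p.1 - p.2) i : ℝ) : ℂ) *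
        G (-p.1 - p.2) j) ∂((volume : Measure (EuclideanSpace ℝ (Fin 3))).prod volume) =
      ∫ p, (2 * Real.pi * Complex.I) * cdot (F p.2) (complexify (-p.1 - p.2)) *
        cdot (F p.1) (G (-p.1 - p.2)) ∂((volume : Measure (EuclideanSpace ℝ (Fin 3))).prod volume) := by
    refine (sum_sum_integral_eq _ (fun i j => integrable_freq_term hFi hFm hGc hGb i j)).trans ?_
    refine integral_congr_ae (Eventually.of_forall fun p => ?_)
    dsimp only
    rw [← sum_sum_eq_cdot]
    refine Finset.sum_congr rfl fun i _ => Finset.sum_congr rfl fun j _ => ?_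
    rw [complexify_apply]
  -- RHS, step 4: the divergence-free condition kills `f̂(ξ₂)·ξ₂`
  have hR4 : ∫ p, (2 * Real.pi * Complex.I) * cdot (F p.2) (complexify (-p.1 - p.2)) *
        cdot (F p.1) (G (-p.1 - p.2)) ∂((volume : Measure (EuclideanSpace ℝ (Fin 3))).prod volume) =
      -(2 * Real.pi * Complex.I) * ∫ p, Tb p ∂((volume : Measure (EuclideanSpace ℝ (Fin 3))).prod volume) := by
    rw [← integral_const_mul]
    refine integral_congr_ae ?_
    filter_upwards [ae_cdot_snd_eq_zero hdf] with p hp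
    rw [hTb]
    dsimp only
    rw [cdot_complexify_neg_sub, hp, sub_zero]
    ring
  rw [hL, hR1]
  simp_rw [hR2]
  rw [hR3, hR4]

end Cubic

end Literature.Analysis.PerpetualPump.PerpetualPumpEulerTypeIGlue

end Part5

/-!
## Part 6 — port of `Summits/NavierStokesRegularity/NavierStokesRegularity/Theorems/PerpetualPumpEulerTypeIGlueHeatPairing.lean` (5 declarations kept)

# Route PerpetualPump · `EulerTypeIGlue` — toolkit IV: Tao's heat propagator and pairing versus
# the tree's caloric extension and `L²` pairing of real fields

Support file for the support item `EulerTypeIGlue` (stmt-NavierStokesRegularity-1838). Tao's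
`H¹⁰_df`-mild solutions (`Literature/Analysis/FluidPDE/TaoAveragedSobolev.lean`) are written with
the Fourier-multiplier heat propagator `Tao2016.heat τ = 𝓕⁻¹ e^{-4π²τ|ξ|²} 𝓕` on `L²(ℝ³; ℂ³)` and
the complex bilinear pairing `Tao2016.pairing`; the tree's mild solutions in duality form
(`Literature.Analysis.FluidPDE.IsMildNSSolutionOn`) use the Gauss–Weierstrass integral
`heatFlow φ τ = heatKernel τ ⋆ φ` of real test fields and the real `L²` pairing. This file
identifies the two:

* `heat_toLp_eq_toLp_heatFlow` — for a real `L²` field `φ` and `τ ≥ 0`,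
  `heat τ [φ^ℂ] = [(heatFlow φ τ)^ℂ]` in `L²(ℝ³; ℂ³)` (both induce the tempered distribution
  `e^{τΔ} T_{[φ^ℂ]}`: the tree's `heatSemigroup_toTemperedDistribution_Lp_holds`, Mathlib's
  compatibility of the `L²` and `𝓢'` Fourier transforms, injectivity of `L² → 𝓢'`);
* `pairing_eq_integral_inner_of_ae_eq` — `pairing v [g^ℂ] = ∫ ⟪f, g⟫` when `v = [f^ℂ]`.

## References

* E. M. Stein, G. Weiss, *Introduction to Fourier Analysis on Euclidean Spaces* (1971), Ch. I,
  Thm. 1.18 and §3 (the Gauss–Weierstrass semigroup as a Fourier multiplier).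
* T. Tao, J. Amer. Math. Soc. 29 (2016), arXiv:1402.0290v3, §1.1 (1.5), (1.15). [Tao2016AveragedNS]
-/

section Part6

open _root_.MeasureTheory _root_.Set _root_.Filter _root_.Topology FourierTransform SchwartzMap TemperedDistribution
open scoped _root_.ENNReal _root_.NNReal FourierTransform RealInnerProductSpace Convolution

namespace Literature.Analysis.PerpetualPump.PerpetualPumpEulerTypeIGlue

open Literature.Analysis.FluidPDE Literature.Analysis.FluidPDE.Tao2016
open Literature.Analysis.UnboundedOperators (heatExtension heatKernel memLp_heatExtension_holds
  heatSymbol_hasTemperateGrowth_holds heatSymbol_hasTemperateGrowth_complex)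
open Literature.Analysis.FunctionSpaces.EuclideanSpace (complexify complexify_apply norm_complexify
  continuous_complexify)

/-! ### Injectivity of `L² → 𝓢'` -/

/-! ### Tao's heat propagator is the Gauss–Weierstrass integral -/

/-- For `τ ≥ 0` Tao's heat symbol is the (complexified) tree heat symbol `e^{-(2π)²τ|ξ|²}`. [folklore]
[cite: Tao2016AveragedNS, §1.1 (1.3)–(1.5), (1.15) pp. 3–7 (the `H¹⁰_df` mild formulation of the true Navier–Stokes form and its Fourier-side calculus) (source of the NOTION / ARGUMENT this module implements; this declaration is the cell’s own lemma or plumbing, NOT a printed statement)] -/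
theorem heatSymbol_eq_of_nonneg {τ : ℝ} (hτ : 0 ≤ τ) (ξ : (EuclideanSpace ℝ (Fin 3))) :
    Tao2016.heatSymbol τ ξ = (Literature.Analysis.UnboundedOperators.heatSymbol τ ξ : ℂ) := by
  rw [Tao2016.heatSymbol, Literature.Analysis.UnboundedOperators.heatSymbol, max_eq_left hτ]
  congr 1
  congr 1
  ring

/-- **Tao's `e^{τΔ}` on `L²(ℝ³; ℂ³)` is the caloric extension** (`τ > 0`): the Fourier multiplier
`𝓕⁻¹ e^{-4π²τ|ξ|²} 𝓕 w` equals the Gauss–Weierstrass integral `heatKernel τ ⋆ w` as `L²` classes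
(both are the tempered distribution `e^{τΔ} T_w`; Stein–Weiss Ch. I Thm. 1.18, §3). [folklore]
[cite: Tao2016AveragedNS, §1.1 (1.3)–(1.5), (1.15) pp. 3–7 (the `H¹⁰_df` mild formulation of the true Navier–Stokes form and its Fourier-side calculus) (source of the NOTION / ARGUMENT this module implements; this declaration is the cell’s own lemma or plumbing, NOT a printed statement)] -/
theorem heat_eq_toLp_heatExtension {τ : ℝ} (hτ : 0 < τ) (w : L2C) :
    heat τ w = (memLp_heatExtension_holds (Lp.memLp w) one_le_two hτ).toLp (heatExtension (w : (EuclideanSpace ℝ (Fin 3)) → (EuclideanSpace ℂ (Fin 3))) τ) := by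
  refine eq_of_toTemperedDistribution_eq ?_
  -- the right-hand side through the tree's `heatSemigroup_toTemperedDistribution_Lp_holds`
  haveI : Fact ((1 : ℝ≥0∞) ≤ 2) := ⟨one_le_two⟩
  have hR := Lp.heatSemigroup_toTemperedDistribution_Lp_holds (E := (EuclideanSpace ℝ (Fin 3))) (F := (EuclideanSpace ℂ (Fin 3)))
    memLp_heatExtension_holds w hτ
  -- symbols
  set g : (EuclideanSpace ℝ (Fin 3)) → ℂ := fun ξ => (Literature.Analysis.UnboundedOperators.heatSymbol τ ξ : ℂ) with hg
  have hgt : g.HasTemperateGrowth :=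
    heatSymbol_hasTemperateGrowth_complex heatSymbol_hasTemperateGrowth_holds hτ.le
  have hgi : MemLp g ⊤ (volume : Measure (EuclideanSpace ℝ (Fin 3))) := by
    refine (memLp_top_heatSymbol τ).ae_eq (Eventually.of_forall fun ξ => ?_)
    exact heatSymbol_eq_of_nonneg hτ.le ξ
  have hsymb : (memLp_top_heatSymbol τ).toLp (Tao2016.heatSymbol τ) = hgi.toLp g :=
    MemLp.toLp_congr _ _ (Eventually.of_forall fun ξ => heatSymbol_eq_of_nonneg hτ.le ξ)
  -- the left-hand side through `𝓢'`
  have hL : (Lp.toTemperedDistribution (heat τ w) : 𝓢'((EuclideanSpace ℝ (Fin 3)), (EuclideanSpace ℂ (Fin 3)))) =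
      TemperedDistribution.heatSemigroup τ (Lp.toTemperedDistribution w) := by
    rw [heat, fourierMultiplier, hsymb, ← Lp.fourierInv_toTemperedDistribution_eq,
      Lp.toTemperedDistribution_smul_eq hgt hgi, ← Lp.fourier_toTemperedDistribution_eq,
      TemperedDistribution.heatSemigroup_eq_fourierMultiplierCLM, TemperedDistribution.fourierMultiplierCLM_apply]
  rw [hL]
  exact hR

/-- The caloric extension commutes with the complexification (a linear isometry commutes with
the Bochner integral). [folklore]
[cite: Tao2016AveragedNS, §1.1 (1.3)–(1.5), (1.15) pp. 3–7 (the `H¹⁰_df` mild formulation of the true Navier–Stokes form and its Fourier-side calculus) (source of the NOTION / ARGUMENT this module implements; this declaration is the cell’s own lemma or plumbing, NOT a printed statement)] -/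
theorem heatExtension_complexify_comp (φ : (EuclideanSpace ℝ (Fin 3)) → (EuclideanSpace ℝ (Fin 3))) (τ : ℝ) :
    heatExtension (complexify ∘ φ) τ = complexify ∘ heatExtension φ τ := by
  funext x
  rw [Literature.Analysis.UnboundedOperators.heatExtension_apply, Function.comp_apply,
    Literature.Analysis.UnboundedOperators.heatExtension_apply,
    ← LinearIsometry.integral_comp_comm complexify (fun y => heatKernel τ y • φ (x - y))]
  refine integral_congr_ae (Eventually.of_forall fun y => ?_)
  simp only [Function.comp_apply, complexify.map_smul]

/-- **Tao's `e^{τΔ}` of a real `L²` field is the tree's `heatFlow`** (`τ ≥ 0`):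
`heat τ [φ^ℂ] = [(heatFlow φ τ)^ℂ]` in `L²(ℝ³; ℂ³)`. [folklore]
[cite: Tao2016AveragedNS, §1.1 (1.3)–(1.5), (1.15) pp. 3–7 (the `H¹⁰_df` mild formulation of the true Navier–Stokes form and its Fourier-side calculus) (source of the NOTION / ARGUMENT this module implements; this declaration is the cell’s own lemma or plumbing, NOT a printed statement)] -/
theorem heat_toLp_eq_toLp_heatFlow {φ : (EuclideanSpace ℝ (Fin 3)) → (EuclideanSpace ℝ (Fin 3))} (hφ : MemLp (complexify ∘ φ) 2 (volume : Measure (EuclideanSpace ℝ (Fin 3))))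
    {τ : ℝ} (hτ : 0 ≤ τ) (hh : MemLp (complexify ∘ heatFlow φ τ) 2 (volume : Measure (EuclideanSpace ℝ (Fin 3)))) :
    heat τ (hφ.toLp _) = hh.toLp _ := by
  rcases hτ.eq_or_lt with h0 | hpos
  · subst h0
    rw [heat_zero]
    exact MemLp.toLp_congr _ _ (Eventually.of_forall fun x => by rw [heatFlow_zero])
  · rw [heat_eq_toLp_heatExtension hpos]
    refine MemLp.toLp_congr _ _ ?_
    rw [Literature.Analysis.UnboundedOperators.heatExtension_congr_ae' hφ.coeFn_toLp τ,
      heatExtension_complexify_comp, heatFlow_of_pos _ hpos]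

/-! ### The pairing of complexified real fields -/

/-- The pairing of a general `L²` class against a complexified real field, when the class is
a.e. a complexified real field. [folklore]
[cite: Tao2016AveragedNS, §1.1 (1.3)–(1.5), (1.15) pp. 3–7 (the `H¹⁰_df` mild formulation of the true Navier–Stokes form and its Fourier-side calculus) (source of the NOTION / ARGUMENT this module implements; this declaration is the cell’s own lemma or plumbing, NOT a printed statement)] -/
theorem pairing_eq_integral_inner_of_ae_eq {v : L2C} {f g : (EuclideanSpace ℝ (Fin 3)) → (EuclideanSpace ℝ (Fin 3))}
    (hv : (v : (EuclideanSpace ℝ (Fin 3)) → (EuclideanSpace ℂ (Fin 3))) =ᵐ[volume] complexify ∘ f)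
    (hg : MemLp (complexify ∘ g) 2 (volume : Measure (EuclideanSpace ℝ (Fin 3)))) :
    Tao2016.pairing v (hg.toLp _) = ((∫ x, ⟪f x, g x⟫ : ℝ) : ℂ) := by
  unfold Tao2016.pairing
  rw [← integral_complex_ofReal]
  refine integral_congr_ae ?_
  filter_upwards [hv, hg.coeFn_toLp] with x hx hy
  rw [hx, hy, Function.comp_apply, Function.comp_apply, cdot_complexify]

end Literature.Analysis.PerpetualPump.PerpetualPumpEulerTypeIGlue

end Part6

/-!
## Part 7 — port of `Summits/NavierStokesRegularity/NavierStokesRegularity/Theorems/PerpetualPumpEulerTypeIGlueDensity.lean` (8 declarations kept)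

# Route PerpetualPump · `EulerTypeIGlue` — density of divergence-free test fields in the real
# divergence-free part of `L²(ℝ³; ℂ³)`

Support file for the support item `EulerTypeIGlue` (stmt-NavierStokesRegularity-1838) of route
PerpetualPump.  Tao's mild solutions (2016, (1.15)) are tested against all `w ∈ H¹⁰_df(ℝ³)`
(`MemH10df`: `H¹⁰`, real, `ξ·ŵ(ξ) = 0` a.e.), the tree's physical-space mild solutions against
`φ ∈ C_{c,σ}^∞` (`divFreeTest`).  To pass from the latter to the former one needs that every real,
Fourier-divergence-free `w ∈ L²(ℝ³; ℂ³)` is an `L²` limit of complexified divergence-free test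
fields (`exists_divFreeTest_tendsto`).  Proof: the real part `Re w ∈ L²(ℝ³; ℝ³)` is weakly
divergence free (`∫ ⟪Re w, ∇θ⟫ = ⟨w, [∇θ^ℂ]⟩ = ∫ ŵ(ξ)·𝓕[∇θ^ℂ](-ξ) dξ = 0`, as
`𝓕[∇θ](η) = 2πi θ̂(η) η` and `ξ·ŵ(ξ) = 0`), hence lies in `L²_σ = closure 𝒱` by the tree's
Helmholtz characterisation `mem_solenoidalL2_iff_holds` (Temam 1977, Ch. I, Thm. 1.4/1.6), and
complexification is isometric.

## References

* R. Temam, *Navier–Stokes Equations* (North-Holland 1977), Ch. I, Thm. 1.4, Rem. 1.6, Thm. 1.6.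
* T. Tao, J. Amer. Math. Soc. 29 (2016), arXiv:1402.0290v3, §1.1 (1.15). [Tao2016AveragedNS]
-/

section Part7

open _root_.MeasureTheory _root_.Set _root_.Filter _root_.Topology FourierTransform
open scoped _root_.ENNReal _root_.NNReal FourierTransform RealInnerProductSpace ComplexConjugate

namespace Literature.Analysis.PerpetualPump.PerpetualPumpEulerTypeIGlue

open Literature.Analysis.FluidPDE Literature.Analysis.FluidPDE.Tao2016
open Literature.Analysis.FunctionSpaces.EuclideanSpace (complexify complexify_apply norm_complexify
  continuous_complexify)

section Density

/-! ### Real parts of real `L²` classes -/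

/-- A vector with real coordinates is the complexification of its real part. [folklore]
[cite: Tao2016AveragedNS, §1.1 (1.3)–(1.5), (1.15) pp. 3–7 (the `H¹⁰_df` mild formulation of the true Navier–Stokes form and its Fourier-side calculus) (source of the NOTION / ARGUMENT this module implements; this declaration is the cell’s own lemma or plumbing, NOT a printed statement)] -/
theorem complexify_realPart_of_im_eq_zero {z : (EuclideanSpace ℂ (Fin 3))} (hz : ∀ i, (z i).im = 0) :
    complexify (realPart z) = z := by
  ext i
  rw [complexify_apply, realPart_apply]
  apply Complex.ext
  · simp
  · simp [hz i]

/-- `‖Re z‖ ≤ ‖z‖`. [folklore]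
[cite: Tao2016AveragedNS, §1.1 (1.3)–(1.5), (1.15) pp. 3–7 (the `H¹⁰_df` mild formulation of the true Navier–Stokes form and its Fourier-side calculus) (source of the NOTION / ARGUMENT this module implements; this declaration is the cell’s own lemma or plumbing, NOT a printed statement)] -/
theorem norm_realPart_le (z : (EuclideanSpace ℂ (Fin 3))) : ‖realPart z‖ ≤ ‖z‖ := by
  have h := lipschitzWith_one_realPart.norm_sub_le z 0
  have h0 : realPart (0 : (EuclideanSpace ℂ (Fin 3))) = 0 := by ext i; simp
  simpa [h0] using h

/-- A real `L²(ℝ³; ℂ³)` class is represented by the complexification of its real part. [folklore]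
[cite: Tao2016AveragedNS, §1.1 (1.3)–(1.5), (1.15) pp. 3–7 (the `H¹⁰_df` mild formulation of the true Navier–Stokes form and its Fourier-side calculus) (source of the NOTION / ARGUMENT this module implements; this declaration is the cell’s own lemma or plumbing, NOT a printed statement)] -/
theorem IsReal.ae_eq_complexify_realPart {w : L2C} (hw : IsReal w) :
    (w : (EuclideanSpace ℝ (Fin 3)) → (EuclideanSpace ℂ (Fin 3))) =ᵐ[volume] complexify ∘ (realPart ∘ (w : (EuclideanSpace ℝ (Fin 3)) → (EuclideanSpace ℂ (Fin 3)))) := by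
  filter_upwards [hw] with x hx
  rw [Function.comp_apply, Function.comp_apply, complexify_realPart_of_im_eq_zero hx]

/-- The real part of an `L²(ℝ³; ℂ³)` class is in `L²(ℝ³; ℝ³)`. [folklore]
[cite: Tao2016AveragedNS, §1.1 (1.3)–(1.5), (1.15) pp. 3–7 (the `H¹⁰_df` mild formulation of the true Navier–Stokes form and its Fourier-side calculus) (source of the NOTION / ARGUMENT this module implements; this declaration is the cell’s own lemma or plumbing, NOT a printed statement)] -/
theorem memLp_realPart (w : L2C) : MemLp (realPart ∘ (w : (EuclideanSpace ℝ (Fin 3)) → (EuclideanSpace ℂ (Fin 3)))) 2 (volume : Measure (EuclideanSpace ℝ (Fin 3))) :=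
  MemLp.of_le (Lp.memLp w) (continuous_realPart.comp_aestronglyMeasurable (Lp.aestronglyMeasurable w))
    (Eventually.of_forall fun _ => norm_realPart_le _)

/-- Complexification preserves `L²`. [folklore]
[cite: Tao2016AveragedNS, §1.1 (1.3)–(1.5), (1.15) pp. 3–7 (the `H¹⁰_df` mild formulation of the true Navier–Stokes form and its Fourier-side calculus) (source of the NOTION / ARGUMENT this module implements; this declaration is the cell’s own lemma or plumbing, NOT a printed statement)] -/
theorem memLp_complexify_of_memLp {g : (EuclideanSpace ℝ (Fin 3)) → (EuclideanSpace ℝ (Fin 3))} (hg : MemLp g 2 (volume : Measure (EuclideanSpace ℝ (Fin 3)))) :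
    MemLp (complexify ∘ g) 2 (volume : Measure (EuclideanSpace ℝ (Fin 3))) :=
  ContinuousLinearMap.comp_memLp' complexify.toContinuousLinearMap hg

/-! ### Fourier-divergence-free ⇒ weakly divergence free -/

/-- **The Fourier transform of a complexified gradient**: `𝓕[(∇θ)^ℂ](η) = (2πi θ̂(η)) η^ℂ` for a
`C¹` compactly supported real `θ` (Stein–Weiss 1971, Ch. I, Thm. 1.8). [folklore]
[cite: Tao2016AveragedNS, §1.1 (1.3)–(1.5), (1.15) pp. 3–7 (the `H¹⁰_df` mild formulation of the true Navier–Stokes form and its Fourier-side calculus) (source of the NOTION / ARGUMENT this module implements; this declaration is the cell’s own lemma or plumbing, NOT a printed statement)] -/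
theorem fourier_complexify_gradient {θ : (EuclideanSpace ℝ (Fin 3)) → ℝ} (hθ : ContDiff ℝ 1 θ) (hθc : HasCompactSupport θ)
    (hΘi : Integrable (complexify ∘ gradient θ)) (η : (EuclideanSpace ℝ (Fin 3))) :
    𝓕 (complexify ∘ gradient θ) η =
      (2 * Real.pi * Complex.I * 𝓕 (fun x => (θ x : ℂ)) η) • complexify η := by
  classical
  ext j
  rw [LerayDivFree.fourier_apply_coord hΘi, PiLp.smul_apply, complexify_apply, smul_eq_mul]
  have hgrad : (fun x => (complexify ∘ gradient θ) x j) =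
      fun x => ((fderiv ℝ θ x (EuclideanSpace.single j 1) : ℝ) : ℂ) := by
    funext x
    simp only [Function.comp_apply, complexify_apply, gradient_apply_eq_fderiv]
  rw [hgrad, fourier_fderiv_apply_ofReal hθ hθc, EuclideanSpace.inner_single_right]
  simp only [conj_trivial, one_mul]
  ring

/-- **A real, Fourier-divergence-free `L²` class has a weakly divergence-free real part**:
`ξ · ŵ(ξ) = 0` a.e. implies `∫ ⟪Re w, ∇θ⟫ = 0` for every test function `θ`
(Parseval `⟨w, z⟩ = ∫ ŵ(ξ)·ẑ(-ξ)` and `𝓕[∇θ^ℂ](η) = 2πi θ̂(η) η`). [folklore]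
[cite: Tao2016AveragedNS, §1.1 (1.3)–(1.5), (1.15) pp. 3–7 (the `H¹⁰_df` mild formulation of the true Navier–Stokes form and its Fourier-side calculus) (source of the NOTION / ARGUMENT this module implements; this declaration is the cell’s own lemma or plumbing, NOT a printed statement)] -/
theorem isWeaklyDivFree_realPart {w : L2C} (hre : IsReal w) (hdf : IsFourierDivFree w) :
    IsWeaklyDivFree (realPart ∘ (w : (EuclideanSpace ℝ (Fin 3)) → (EuclideanSpace ℂ (Fin 3)))) := by
  intro θ hθ
  have hθ1 : ContDiff ℝ 1 θ := hθ.contDiff.of_le (by exact_mod_cast le_top)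
  have hgc : Continuous (gradient θ) :=
    (InnerProductSpace.toDual ℝ (EuclideanSpace ℝ (Fin 3))).symm.continuous.comp (hθ.contDiff.continuous_fderiv (by simp))
  have hgs : HasCompactSupport (gradient θ) :=
    (hθ.hasCompactSupport.fderiv (𝕜 := ℝ)).comp_left
      (g := (InnerProductSpace.toDual ℝ (EuclideanSpace ℝ (Fin 3))).symm) (map_zero _)
  have hΘc : Continuous (complexify ∘ gradient θ) := continuous_complexify.comp hgc
  have hΘs : HasCompactSupport (complexify ∘ gradient θ) := hgs.comp_left (map_zero _)
  have hΘi : Integrable (complexify ∘ gradient θ) := hΘc.integrable_of_hasCompactSupport hΘs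
  have hΘ2 : MemLp (complexify ∘ gradient θ) 2 (volume : Measure (EuclideanSpace ℝ (Fin 3))) :=
    hΘc.memLp_of_hasCompactSupport hΘs
  -- physical side
  have hx := pairing_eq_integral_inner_of_ae_eq (IsReal.ae_eq_complexify_realPart hre) hΘ2
  -- Fourier side
  have hF : pairing w (hΘ2.toLp _) = 0 := by
    rw [pairing_eq_integral_cdot_fourierFn]
    have h1 : fourierFn (hΘ2.toLp _) =ᵐ[volume] 𝓕 (complexify ∘ gradient θ) :=
      Literature.Analysis.FunctionSpaces.fourier_toLp_ae_eq_fourierIntegral hΘi hΘ2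
    have h2 : ∀ᵐ ξ : (EuclideanSpace ℝ (Fin 3)) ∂volume, fourierFn (hΘ2.toLp _) (-ξ) = 𝓕 (complexify ∘ gradient θ) (-ξ) :=
      (Measure.measurePreserving_neg (volume : Measure (EuclideanSpace ℝ (Fin 3)))).quasiMeasurePreserving.ae_eq h1
    refine (integral_congr_ae ?_).trans (integral_zero _ _)
    filter_upwards [h2, hdf] with ξ hξ hdiv
    have hneg : cdot (fourierFn w ξ) (complexify (-ξ)) = -cdot (complexify ξ) (fourierFn w ξ) := by
      unfold cdot
      rw [← Finset.sum_neg_distrib]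
      refine Finset.sum_congr rfl fun i _ => ?_
      rw [map_neg, PiLp.neg_apply]
      ring
    rw [hξ, fourier_complexify_gradient hθ1 hθ.hasCompactSupport hΘi, cdot_smul_right, hneg, hdiv,
      neg_zero, mul_zero]
  rw [hF] at hx
  exact_mod_cast hx.symm

/-! ### The density statement -/

/-- **`C_{c,σ}^∞` is dense in the real divergence-free part of `L²(ℝ³; ℂ³)`**: a real,
Fourier-divergence-free `w ∈ L²(ℝ³; ℂ³)` is the `L²` limit of complexified smooth compactly
supported divergence-free fields (Temam 1977, Ch. I, Thm. 1.4/1.6, `L²_σ = closure 𝒱`, through the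
tree's `mem_solenoidalL2_iff_holds` and `denseRange_divFreeTestToSolenoidalL2`). [cite: Temam1977, Ch. I Thm. 1.4 with Rem. 1.6 / Thm. 1.6] -/
theorem exists_divFreeTest_tendsto {w : L2C} (hre : IsReal w) (hdf : IsFourierDivFree w) :
    ∃ (φ : ℕ → ((EuclideanSpace ℝ (Fin 3)) → (EuclideanSpace ℝ (Fin 3)))) (_ : ∀ n, φ n ∈ divFreeTest (EuclideanSpace ℝ (Fin 3)))
      (h2 : ∀ n, MemLp (complexify ∘ φ n) 2 (volume : Measure (EuclideanSpace ℝ (Fin 3)))),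
      Tendsto (fun n => ((h2 n).toLp (complexify ∘ φ n) : L2C)) atTop (𝓝 w) := by
  set f : (EuclideanSpace ℝ (Fin 3)) → (EuclideanSpace ℝ (Fin 3)) := realPart ∘ (w : (EuclideanSpace ℝ (Fin 3)) → (EuclideanSpace ℂ (Fin 3))) with hf
  have hf2 : MemLp f 2 (volume : Measure (EuclideanSpace ℝ (Fin 3))) := memLp_realPart w
  have hwf : (w : (EuclideanSpace ℝ (Fin 3)) → (EuclideanSpace ℂ (Fin 3))) =ᵐ[volume] complexify ∘ f := IsReal.ae_eq_complexify_realPart hre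
  set F : Lp (EuclideanSpace ℝ (Fin 3)) 2 (volume : Measure (EuclideanSpace ℝ (Fin 3))) := hf2.toLp f with hF
  have hFdiv : IsWeaklyDivFree (F : (EuclideanSpace ℝ (Fin 3)) → (EuclideanSpace ℝ (Fin 3))) :=
    (isWeaklyDivFree_realPart hre hdf).congr_ae hf2.coeFn_toLp.symm
  have hFmem : F ∈ solenoidalL2 (EuclideanSpace ℝ (Fin 3)) := (mem_solenoidalL2_iff_holds F).2 hFdiv
  -- a sequence of divergence-free test fields converging to `F` in `L²(ℝ³; ℝ³)`
  have hcl : (⟨F, hFmem⟩ : solenoidalL2 (EuclideanSpace ℝ (Fin 3))) ∈ closure (range (divFreeTestToSolenoidalL2 (EuclideanSpace ℝ (Fin 3)))) := by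
    rw [denseRange_divFreeTestToSolenoidalL2.closure_range]
    exact mem_univ _
  obtain ⟨x, hx, hxt⟩ := mem_closure_iff_seq_limit.1 hcl
  choose ψ hψ using hx
  have h2c : ∀ n, MemLp (complexify ∘ (ψ n : (EuclideanSpace ℝ (Fin 3)) → (EuclideanSpace ℝ (Fin 3)))) 2 (volume : Measure (EuclideanSpace ℝ (Fin 3))) := fun n =>
    memLp_complexify_of_memLp (memLp_of_mem_divFreeTest (ψ n).2 2)
  refine ⟨fun n => (ψ n : (EuclideanSpace ℝ (Fin 3)) → (EuclideanSpace ℝ (Fin 3))), fun n => (ψ n).2, h2c, ?_⟩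
  have hT : Tendsto (fun n => (divFreeTestToL2 (EuclideanSpace ℝ (Fin 3)) (ψ n) : Lp (EuclideanSpace ℝ (Fin 3)) 2 (volume : Measure (EuclideanSpace ℝ (Fin 3))))) atTop (𝓝 F) := by
    have h := (continuous_subtype_val.tendsto _).comp hxt
    refine h.congr fun n => ?_
    rw [Function.comp_apply, ← hψ n, coe_divFreeTestToSolenoidalL2]
  rw [tendsto_iff_norm_sub_tendsto_zero] at hT ⊢
  refine hT.congr fun n => ?_
  rw [Lp.norm_def, Lp.norm_def]
  congr 1
  refine eLpNorm_congr_norm_ae ?_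
  filter_upwards [Lp.coeFn_sub (divFreeTestToL2 (EuclideanSpace ℝ (Fin 3)) (ψ n)) F, coeFn_divFreeTestToL2 (ψ n),
    hf2.coeFn_toLp, Lp.coeFn_sub ((h2c n).toLp _) w, (h2c n).coeFn_toLp, hwf]
    with y h1 h2 h3 h4 h5 h6
  rw [h1, Pi.sub_apply, h2, h3, h4, Pi.sub_apply, h5, h6, Function.comp_apply,
    Function.comp_apply, ← map_sub, norm_complexify]

end Density

end Literature.Analysis.PerpetualPump.PerpetualPumpEulerTypeIGlue

end Part7

/-!
## Part 8 — port of `Summits/NavierStokesRegularity/NavierStokesRegularity/Theorems/PerpetualPumpEulerTypeIGlueIdentityTests.lean` (2 declarations kept)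

# Route PerpetualPump · `EulerTypeIGlue` — stub `stub_identityTests` (line `Sketch`)

Tao's mild identity (2016, §1.1 (1.5)/(1.15)) at viscosity `ν`, tested against the
divergence-free test fields `φ ∈ C_{c,σ}^∞(ℝ³)` (`divFreeTest ℝ³`), for the complexified `L²`
curve `U t = [(u t)^ℂ] ∈ L²(ℝ³; ℂ³)` of a classical Leray–Hopf solution `u` on `[0,T)`:
`⟨U t, φ⟩ = ⟨e^{νtΔ} U 0, φ⟩ + ∫₀ᵗ ⟨B(U s, U s), e^{ν(t-s)Δ} φ⟩ ds`.

This is a dictionary statement.  The physical-space duality identity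
`∫⟪u t, φ⟫ = ∫⟪u 0, e^{νtΔ}φ⟫ + ∫₀ᵗ ∫⟪u τ, (u τ·∇) e^{ν(t-τ)Δ}φ⟫ dτ` (Fabes–Jones–Rivière 1972,
Thm. 2.1) is the mild clause of `isKatoSolutionOn_of_classical`; its three terms are carried to
Tao's side by `pairing_eq_integral_inner_of_ae_eq` (the bilinear pairing of complexified real
fields is the real `L²` pairing), `pairing_heat_left` + `heat_toLp_eq_toLp_heatFlow` (Tao's
Fourier-multiplier `e^{τΔ}` is self-adjoint and is the Gauss–Weierstrass flow `heatFlow`), and the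
cubic Plancherel identity `⟨B([f^ℂ],[f^ℂ]),[ψ^ℂ]⟩ = ∫⟪f,(f·∇)ψ⟫` (hypothesis `hcubic`, applied at
each time `s ∈ [0,t]` to `f = u s` and the caloric test field `ψ = e^{ν(t-s)Δ}φ`, which is
`C¹`, integrable with integrable derivative, and square integrable: `caloricTest_regularity`).

## References

* T. Tao, *Finite time blowup for an averaged three-dimensional Navier–Stokes equation*,
  J. Amer. Math. Soc. 29 (2016), arXiv:1402.0290v3, §1.1 (1.5), (1.15). [Tao2016AveragedNS]
* E. B. Fabes, B. F. Jones, N. M. Rivière, Arch. Rational Mech. Anal. 45 (1972), Thm. 2.1.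
-/

section Part8

open _root_.MeasureTheory _root_.Set _root_.Filter _root_.Topology FourierTransform
open scoped _root_.ENNReal _root_.NNReal RealInnerProductSpace SchwartzMap _root_.ContDiff

namespace Literature.Analysis.PerpetualPump.PerpetualPumpEulerTypeIGlue

open Literature.Analysis.FluidPDE Literature.Analysis.FluidPDE.Tao2016
open Literature.Analysis.FunctionSpaces (eFourierSobolevNorm)
open Literature.Analysis.FunctionSpaces.EuclideanSpace (complexify complexify_apply norm_complexify
  continuous_complexify)

/-! ### The caloric test field `e^{σΔ}φ` of a divergence-free test field -/

/-- **Regularity of the caloric test field**: for `φ ∈ C_{c,σ}^∞(ℝ³)` and every `σ ∈ ℝ`, the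
field `ψ = heatFlow φ σ` (`= e^{σΔ}φ` for `σ > 0`, `= φ` for `σ ≤ 0`) is `C¹`, integrable, has an
integrable derivative (`Dψ = e^{σΔ} Dφ`), and its complexification is square integrable
(derivatives fall on the compactly supported data; `L¹`/`L²` contractivity of the heat flow).
[folklore]
[cite: Tao2016AveragedNS, §1.1 (1.3)–(1.5), (1.15) pp. 3–7 (the `H¹⁰_df` mild formulation of the true Navier–Stokes form and its Fourier-side calculus) (source of the NOTION / ARGUMENT this module implements; this declaration is the cell’s own lemma or plumbing, NOT a printed statement)] -/
theorem caloricTest_regularity {φ : (EuclideanSpace ℝ (Fin 3)) → (EuclideanSpace ℝ (Fin 3))} (hφ : φ ∈ divFreeTest (EuclideanSpace ℝ (Fin 3))) (σ : ℝ) :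
    ContDiff ℝ 1 (heatFlow φ σ) ∧ Integrable (heatFlow φ σ) ∧
      Integrable (fderiv ℝ (heatFlow φ σ)) ∧
      MemLp (complexify ∘ heatFlow φ σ) 2 (volume : Measure (EuclideanSpace ℝ (Fin 3))) := by
  have hc : HasCompactSupport φ := hφ.1.hasCompactSupport
  have h1 : ContDiff ℝ 1 φ := hφ.1.contDiff.of_le (by exact_mod_cast le_top)
  refine ⟨contDiff_heatFlow h1 hc σ,
    integrable_heatFlow (hφ.1.contDiff.continuous.integrable_of_hasCompactSupport hc) σ, ?_,
    memLp_complexify_of_memLp (memLp_heatFlow_of_memLp (memLp_of_mem_divFreeTest hφ 2) one_le_two σ)⟩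
  have heq : fderiv ℝ (heatFlow φ σ) = heatFlow (fderiv ℝ φ) σ := funext (fderiv_heatFlow h1 hc σ)
  rw [heq]
  exact integrable_heatFlow
    ((h1.continuous_fderiv one_ne_zero).integrable_of_hasCompactSupport (hc.fderiv ℝ)) σ

/-! ### Tao's identity (1.15) at viscosity `ν` for test fields -/

/-- **Tao's identity (1.15) at viscosity `ν` for divergence-free test fields**: for the
complexified curve `U t = [(u t)^ℂ]` of a classical Leray–Hopf solution, every `t ∈ [0,T)` and
every `φ ∈ C_{c,σ}^∞`,
`⟨U t, φ⟩ = ⟨e^{νtΔ} U 0, φ⟩ + ∫₀ᵗ ⟨B(U s, U s), e^{ν(t-s)Δ} φ⟩ ds` (x-mild identity of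
`isKatoSolutionOn_of_classical` + heat dictionary + the cubic identity `hcubic`).
[cite: Tao2016AveragedNS, §1.1 (1.5), (1.15)] -/
theorem stub_identityTests {ν T : ℝ} (hν : 0 < ν) (hT : 0 < T) {u : ℝ → (EuclideanSpace ℝ (Fin 3)) → (EuclideanSpace ℝ (Fin 3))} {p : ℝ → (EuclideanSpace ℝ (Fin 3)) → ℝ}
    (hcl : IsClassicalNSSolutionOn (Ico 0 T) ν 0 u p) (hLH : IsLerayHopfOn T ν 0 (u 0) u)
    (hdec : HasRapidSpatialDecay (u 0)) (U : ℝ → L2C)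
    (hU : ∀ t ∈ Ico 0 T, ((U t : L2C) : (EuclideanSpace ℝ (Fin 3)) → (EuclideanSpace ℂ (Fin 3))) =ᵐ[volume] complexify ∘ u t)
    (hH : ∀ t ∈ Ico 0 T, MemH10df (U t))
    (hcubic : ∀ {f ψ : (EuclideanSpace ℝ (Fin 3)) → (EuclideanSpace ℝ (Fin 3))} (_ : Continuous f) (h2 : MemLp (complexify ∘ f) 2 (volume : Measure (EuclideanSpace ℝ (Fin 3))))
      (_ : eFourierSobolevNorm 10 (h2.toLp _) < ⊤) (_ : IsFourierDivFree (h2.toLp _))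
      (_ : ContDiff ℝ 1 ψ) (_ : Integrable ψ) (_ : Integrable (fderiv ℝ ψ))
      (hψ2 : MemLp (complexify ∘ ψ) 2 (volume : Measure (EuclideanSpace ℝ (Fin 3)))),
      eulerForm (h2.toLp _) (h2.toLp _) (hψ2.toLp _) = ((∫ x, ⟪f x, convect f ψ x⟫ : ℝ) : ℂ)) :
    ∀ t ∈ Ico 0 T, ∀ φ ∈ divFreeTest (EuclideanSpace ℝ (Fin 3)), ∀ (h2φ : MemLp (complexify ∘ φ) 2 (volume : Measure (EuclideanSpace ℝ (Fin 3)))),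
      pairing (U t) (h2φ.toLp _) = pairing (heat (ν * t) (U 0)) (h2φ.toLp _) +
        ∫ s in (0:ℝ)..t, eulerForm (U s) (U s) (heat (ν * (t - s)) (h2φ.toLp _)) := by
  intro t ht φ hφ h2φ
  have h0T : (0 : ℝ) ∈ Ico 0 T := ⟨le_rfl, hT⟩
  -- (1) the physical-space mild identity (Fabes–Jones–Rivière) of the classical solution
  have hK : IsKatoSolutionOn T ν (u 0) u := isKatoSolutionOn_of_classical hν hT hcl hLH hdec
  have hmild : ∫ x, ⟪u t x, φ x⟫ = (∫ x, ⟪u 0 x, heatFlow φ (ν * t) x⟫) +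
      ∫ τ in (0:ℝ)..t, ∫ x, ⟪u τ x, convect (u τ) (heatFlow φ (ν * (t - τ))) x⟫ := by
    have h := hK.mild.2 t ht φ hφ.1 hφ.2
    simp only [heatTest, Pi.zero_apply, inner_zero_left, integral_zero,
      intervalIntegral.integral_zero, add_zero] at h
    exact h
  -- (2) the left-hand side
  rw [pairing_eq_integral_inner_of_ae_eq (hU t ht) h2φ]
  -- (3) the datum term: `⟨e^{νtΔ} U 0, φ⟩ = ⟨U 0, e^{νtΔ} φ⟩ = ∫⟪u 0, e^{νtΔ}φ⟫`
  have hh0 : MemLp (complexify ∘ heatFlow φ (ν * t)) 2 (volume : Measure (EuclideanSpace ℝ (Fin 3))) :=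
    (caloricTest_regularity hφ (ν * t)).2.2.2
  rw [pairing_heat_left, heat_toLp_eq_toLp_heatFlow h2φ (mul_nonneg hν.le ht.1) hh0,
    pairing_eq_integral_inner_of_ae_eq (hU 0 h0T) hh0]
  -- (4) the Duhamel term, pointwise in `s ∈ [0, t]`, through the cubic identity
  have hI : ∀ s ∈ uIcc (0:ℝ) t, eulerForm (U s) (U s) (heat (ν * (t - s)) (h2φ.toLp _)) =
      ((∫ x, ⟪u s x, convect (u s) (heatFlow φ (ν * (t - s))) x⟫ : ℝ) : ℂ) := by
    intro s hs
    rw [uIcc_of_le ht.1] at hs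
    have hs' : s ∈ Ico 0 T := ⟨hs.1, hs.2.trans_lt ht.2⟩
    have h2s : MemLp (complexify ∘ u s) 2 (volume : Measure (EuclideanSpace ℝ (Fin 3))) := (Lp.memLp (U s)).ae_eq (hU s hs')
    have hUs : U s = h2s.toLp _ := Lp.ext ((hU s hs').trans h2s.coeFn_toLp.symm)
    have hHs : MemH10df (U s) := hH s hs'
    rw [hUs] at hHs ⊢
    obtain ⟨hψ1, hψi, hψi', hψ2⟩ := caloricTest_regularity hφ (ν * (t - s))
    rw [heat_toLp_eq_toLp_heatFlow h2φ (mul_nonneg hν.le (sub_nonneg.2 hs.2)) hψ2]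
    exact hcubic (hcl.contDiff_velocity hs').continuous h2s hHs.1 hHs.2.2 hψ1 hψi hψi' hψ2
  have hI' : (∫ s in (0:ℝ)..t, eulerForm (U s) (U s) (heat (ν * (t - s)) (h2φ.toLp _))) =
      ((∫ s in (0:ℝ)..t, ∫ x, ⟪u s x, convect (u s) (heatFlow φ (ν * (t - s))) x⟫ : ℝ) : ℂ) := by
    rw [← intervalIntegral.integral_ofReal]
    exact intervalIntegral.integral_congr hI
  -- (5) assemble
  rw [hI', hmild, Complex.ofReal_add]

end Literature.Analysis.PerpetualPump.PerpetualPumpEulerTypeIGlue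

end Part8

/-!
## Part 9 — port of `Summits/NavierStokesRegularity/NavierStokesRegularity/Theorems/PerpetualPumpEulerTypeIGlueDuhamel.lean` (10 declarations kept)

# Route PerpetualPump · `EulerTypeIGlue` — toolkit V: the Duhamel integrand of Tao's mild
# formulation is continuous in time

Support file for the support item `EulerTypeIGlue` (stmt-NavierStokesRegularity-1838). For an
`H¹⁰`-continuous, `H¹⁰`-bounded curve `v` and any `w ∈ L²(ℝ³; ℂ³)`, the Duhamel integrand of
Tao's mild formulation (1.15), `s ↦ ⟨B(v(s), v(s)), e^{(t-s)Δ} w⟩`, is continuous (hence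
interval integrable), because the Euler form is bounded and trilinear on `H¹⁰ × H¹⁰ × L²`
(`enorm_eulerForm_le`, `eulerForm_add_smulᵢ`) and the heat propagator is strongly continuous on
`L²` (`continuous_heat_apply`, dominated convergence on the Fourier side). Also: the heat
propagator is symmetric for the bilinear pairing (tree: `Tao2016.pairing_heat_left`).

## References

* T. Tao, J. Amer. Math. Soc. 29 (2016), arXiv:1402.0290v3, §1.1 (1.3), (1.5), (1.15), p. 7
  (absolute convergence of the forms). [Tao2016AveragedNS]

Not carried from this source module (not needed by the declarations re-homed here; their consumers are Summits-side): `continuousOn_eulerForm_heat`, `intervalIntegrable_eulerForm_heat`.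
-/

section Part9

open _root_.MeasureTheory _root_.Set _root_.Filter _root_.Topology FourierTransform
open scoped _root_.ENNReal _root_.NNReal FourierTransform

namespace Literature.Analysis.PerpetualPump.PerpetualPumpEulerTypeIGlue

open Literature.Analysis.FluidPDE Literature.Analysis.FluidPDE.Tao2016
open Literature.Analysis.FunctionSpaces (eFourierSobolevNorm)

/-! ### Strong continuity of the heat propagator on `L²` -/

/-- The difference of two heat propagators is the Fourier multiplier with the difference of the
symbols (a.e. on the Fourier side). [folklore]
[cite: Tao2016AveragedNS, §1.1 (1.3)–(1.5), (1.15) pp. 3–7 (the `H¹⁰_df` mild formulation of the true Navier–Stokes form and its Fourier-side calculus) (source of the NOTION / ARGUMENT this module implements; this declaration is the cell’s own lemma or plumbing, NOT a printed statement)] -/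
theorem fourierFn_heat_sub_heat (τ τ₀ : ℝ) (w : L2C) :
    fourierFn (heat τ w - heat τ₀ w) =ᵐ[volume]
      fun ξ => (heatSymbol τ ξ - heatSymbol τ₀ ξ) • fourierFn w ξ := by
  have hsub : fourierFn (heat τ w - heat τ₀ w) =ᵐ[volume] fourierFn (heat τ w) - fourierFn (heat τ₀ w) := by
    unfold fourierFn
    have h : (𝓕 (heat τ w - heat τ₀ w) : L2C) = (𝓕 (heat τ w) : L2C) - 𝓕 (heat τ₀ w) :=
      (Lp.fourierTransformₗᵢ (EuclideanSpace ℝ (Fin 3)) (EuclideanSpace ℂ (Fin 3))).map_sub (heat τ w) (heat τ₀ w)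
    rw [h]
    exact Lp.coeFn_sub _ _
  filter_upwards [hsub, fourierFn_heat τ w, fourierFn_heat τ₀ w] with ξ h h1 h2
  rw [h, Pi.sub_apply, h1, h2, sub_smul]

/-- `‖u‖² = ∫ ‖û‖²` (Plancherel) in `ℝ≥0∞`. [folklore]
[cite: Tao2016AveragedNS, §1.1 (1.3)–(1.5), (1.15) pp. 3–7 (the `H¹⁰_df` mild formulation of the true Navier–Stokes form and its Fourier-side calculus) (source of the NOTION / ARGUMENT this module implements; this declaration is the cell’s own lemma or plumbing, NOT a printed statement)] -/
theorem enorm_sq_eq_lintegral_fourierFn (u : L2C) : ‖u‖ₑ ^ 2 = ∫⁻ ξ, ‖fourierFn u ξ‖ₑ ^ 2 := by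
  rw [← lintegral_enorm_sq_fourierFn_rpow_eq, ← ENNReal.rpow_natCast, ← ENNReal.rpow_mul]
  norm_num

/-- **Strong continuity of `τ ↦ e^{τΔ}w` on `L²(ℝ³; ℂ³)`** (dominated convergence on the Fourier
side: `|e^{-4π²τ|ξ|²} - e^{-4π²τ₀|ξ|²}|² |ŵ|² ≤ 4|ŵ|²`). [folklore]
[cite: Tao2016AveragedNS, §1.1 (1.3)–(1.5), (1.15) pp. 3–7 (the `H¹⁰_df` mild formulation of the true Navier–Stokes form and its Fourier-side calculus) (source of the NOTION / ARGUMENT this module implements; this declaration is the cell’s own lemma or plumbing, NOT a printed statement)] -/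
theorem continuous_heat_apply (w : L2C) : Continuous fun τ : ℝ => heat τ w := by
  refine continuous_iff_continuousAt.2 fun τ₀ => ?_
  rw [ContinuousAt, tendsto_iff_norm_sub_tendsto_zero]
  -- the squared norm as a Fourier-side integral
  have hsq : ∀ τ, ‖heat τ w - heat τ₀ w‖ₑ ^ 2 =
      ∫⁻ ξ, ‖heatSymbol τ ξ - heatSymbol τ₀ ξ‖ₑ ^ 2 * ‖fourierFn w ξ‖ₑ ^ 2 := by
    intro τ
    rw [enorm_sq_eq_lintegral_fourierFn]
    refine lintegral_congr_ae ?_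
    filter_upwards [fourierFn_heat_sub_heat τ τ₀ w] with ξ hξ
    rw [hξ, enorm_smul, mul_pow]
  -- dominated convergence
  have hlim : Tendsto (fun τ => ∫⁻ ξ, ‖heatSymbol τ ξ - heatSymbol τ₀ ξ‖ₑ ^ 2 * ‖fourierFn w ξ‖ₑ ^ 2)
      (𝓝 τ₀) (𝓝 0) := by
    have hmeas : ∀ τ, AEMeasurable
        (fun ξ => ‖heatSymbol τ ξ - heatSymbol τ₀ ξ‖ₑ ^ 2 * ‖fourierFn w ξ‖ₑ ^ 2) volume := fun τ =>
      ((((continuous_heatSymbol τ).sub (continuous_heatSymbol τ₀)).aestronglyMeasurable.enorm.pow_const 2)).mul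
        ((aestronglyMeasurable_fourierFn w).enorm.pow_const 2)
    have hfin : ∫⁻ ξ, 4 * ‖fourierFn w ξ‖ₑ ^ 2 ≠ ⊤ := by
      rw [lintegral_const_mul'' _ ((aestronglyMeasurable_fourierFn w).enorm.pow_const 2),
        ← enorm_sq_eq_lintegral_fourierFn]
      exact ENNReal.mul_ne_top (by norm_num) (ENNReal.pow_ne_top enorm_ne_top)
    have h0 : (0 : ℝ≥0∞) = ∫⁻ _ξ : (EuclideanSpace ℝ (Fin 3)), 0 := lintegral_zero.symm
    rw [h0]
    refine tendsto_lintegral_filter_of_dominated_convergence' (fun ξ => 4 * ‖fourierFn w ξ‖ₑ ^ 2)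
      (Eventually.of_forall hmeas) (Eventually.of_forall fun τ => Eventually.of_forall fun ξ => ?_) hfin
      (Eventually.of_forall fun ξ => ?_)
    · -- domination
      refine mul_le_mul' ?_ le_rfl
      have h1 : ‖heatSymbol τ ξ - heatSymbol τ₀ ξ‖ₑ ≤ 2 := by
        refine (enorm_sub_le).trans ?_
        calc ‖heatSymbol τ ξ‖ₑ + ‖heatSymbol τ₀ ξ‖ₑ ≤ 1 + 1 := add_le_add (enorm_heatSymbol_le τ ξ) (enorm_heatSymbol_le τ₀ ξ)
          _ = 2 := by norm_num
      calc ‖heatSymbol τ ξ - heatSymbol τ₀ ξ‖ₑ ^ 2 ≤ 2 ^ 2 := by gcongr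
        _ = 4 := by norm_num
    · -- pointwise convergence
      have hc : Continuous fun τ : ℝ => heatSymbol τ ξ :=
        continuous_heatSymbol₂.comp (continuous_id.prodMk continuous_const)
      have ht : Tendsto (fun τ => ‖heatSymbol τ ξ - heatSymbol τ₀ ξ‖ₑ ^ 2 * ‖fourierFn w ξ‖ₑ ^ 2) (𝓝 τ₀)
          (𝓝 (‖heatSymbol τ₀ ξ - heatSymbol τ₀ ξ‖ₑ ^ 2 * ‖fourierFn w ξ‖ₑ ^ 2)) := by
        refine ENNReal.Tendsto.mul_const (ENNReal.Tendsto.pow ?_) (Or.inr (ENNReal.pow_ne_top enorm_ne_top))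
        exact (continuous_enorm.comp (hc.sub continuous_const)).continuousAt.tendsto
      simpa using ht
  -- back to the norm
  have hlim' : Tendsto (fun τ => ‖heat τ w - heat τ₀ w‖ₑ) (𝓝 τ₀) (𝓝 0) := by
    have h2 : Tendsto (fun τ => (‖heat τ w - heat τ₀ w‖ₑ ^ 2) ^ (1 / 2 : ℝ)) (𝓝 τ₀) (𝓝 (0 ^ (1 / 2 : ℝ))) := by
      simp_rw [hsq]
      exact (ENNReal.continuous_rpow_const.tendsto 0).comp hlim
    rw [ENNReal.zero_rpow_of_pos (by norm_num)] at h2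
    refine h2.congr fun τ => ?_
    rw [← ENNReal.rpow_natCast, ← ENNReal.rpow_mul]
    norm_num
  have h3 := (ENNReal.tendsto_toReal ENNReal.zero_ne_top).comp hlim'
  rw [ENNReal.toReal_zero] at h3
  refine h3.congr fun τ => ?_
  rw [Function.comp_apply, toReal_enorm]

/-! ### The Euler form: real-valued bound and differences -/

/-- The constant `K = (∫ (1+|ξ|²)^{-10})^{1/2}` of `H¹⁰ ⊂ 𝓕L¹`, as a real number. [folklore]
[cite: Tao2016AveragedNS, §1.1 (1.3)–(1.5), (1.15) pp. 3–7 (the `H¹⁰_df` mild formulation of the true Navier–Stokes form and its Fourier-side calculus) (source of the NOTION / ARGUMENT this module implements; this declaration is the cell’s own lemma or plumbing, NOT a printed statement)] -/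
theorem sobolevTen_const_lt_top :
    (∫⁻ ξ : (EuclideanSpace ℝ (Fin 3)), ENNReal.ofReal ((1 + ‖ξ‖ ^ 2) ^ (-10 : ℝ))) ^ (1 / 2 : ℝ) < ⊤ :=
  ENNReal.rpow_lt_top_of_nonneg (by norm_num) lintegral_inv_sobolevWeight_lt_top.ne

/-- **Real-valued bound for the Euler form on `H¹⁰ × H¹⁰ × L²`**:
`|⟨B(u,v), w⟩| ≤ 2πK ‖u‖_{H¹⁰} ‖v‖_{H¹⁰} ‖w‖`. [cite: Tao2016AveragedNS, §1.1 (1.3) p. 3] -/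
theorem norm_eulerForm_le {u v : L2C} (w : L2C) (hu : eFourierSobolevNorm 10 u < ⊤)
    (hv : eFourierSobolevNorm 10 v < ⊤) :
    ‖eulerForm u v w‖ ≤ (Real.pi * (2 * ((∫⁻ ξ : (EuclideanSpace ℝ (Fin 3)), ENNReal.ofReal ((1 + ‖ξ‖ ^ 2) ^ (-10 : ℝ))) ^
      (1 / 2 : ℝ)).toReal)) * (eFourierSobolevNorm 10 u).toReal * (eFourierSobolevNorm 10 v).toReal * ‖w‖ := by
  have h := enorm_eulerForm_le u v w
  have hK := sobolevTen_const_lt_top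
  have hfin : ENNReal.ofReal Real.pi * (2 * (∫⁻ ξ : (EuclideanSpace ℝ (Fin 3)), ENNReal.ofReal ((1 + ‖ξ‖ ^ 2) ^ (-10 : ℝ))) ^
      (1 / 2 : ℝ) * eFourierSobolevNorm 10 u * eFourierSobolevNorm 10 v * ‖w‖ₑ) ≠ ⊤ := by
    refine ENNReal.mul_ne_top ENNReal.ofReal_ne_top ?_
    exact ENNReal.mul_ne_top (ENNReal.mul_ne_top (ENNReal.mul_ne_top
      (ENNReal.mul_ne_top (by norm_num) hK.ne) hu.ne) hv.ne) enorm_ne_top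
  have h' := ENNReal.toReal_mono hfin h
  rw [toReal_enorm] at h'
  refine h'.trans (le_of_eq ?_)
  rw [ENNReal.toReal_mul, ENNReal.toReal_ofReal Real.pi_pos.le, ENNReal.toReal_mul, ENNReal.toReal_mul,
    ENNReal.toReal_mul, ENNReal.toReal_mul, toReal_enorm]
  norm_num
  ring

/-- `⟨B(u,v), z⟩ - ⟨B(u,v), z'⟩ = ⟨B(u,v), z - z'⟩` on `H¹⁰`. [cite: Tao2016AveragedNS, §1.1 (1.3)] -/
theorem eulerForm_sub₃ {u v : L2C} (z z' : L2C) (hu : eFourierSobolevNorm 10 u < ⊤)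
    (hv : eFourierSobolevNorm 10 v < ⊤) :
    eulerForm u v z - eulerForm u v z' = eulerForm u v (z - z') := by
  have h := eulerForm_add_smul₃ (-1) z z' hu hv
  rw [neg_one_smul, ← sub_eq_add_neg] at h
  rw [h]
  ring

/-- `H¹⁰` norms of differences are finite. [folklore]
[cite: Tao2016AveragedNS, §1.1 (1.3)–(1.5), (1.15) pp. 3–7 (the `H¹⁰_df` mild formulation of the true Navier–Stokes form and its Fourier-side calculus) (source of the NOTION / ARGUMENT this module implements; this declaration is the cell’s own lemma or plumbing, NOT a printed statement)] -/
theorem eFourierSobolevNorm_sub_lt_top {x x' : L2C} (hx : eFourierSobolevNorm 10 x < ⊤)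
    (hx' : eFourierSobolevNorm 10 x' < ⊤) : eFourierSobolevNorm 10 (x - x') < ⊤ := by
  have h1 : eFourierSobolevNorm 10 (x - x') ≤ eFourierSobolevNorm 10 x + eFourierSobolevNorm 10 x' := by
    have h := eFourierSobolevNorm_add_le 10 x (-x')
    rwa [eFourierSobolevNorm_neg, ← sub_eq_add_neg] at h
  exact lt_of_le_of_lt h1 (ENNReal.add_lt_top.2 ⟨hx, hx'⟩)

/-- `⟨B(x,v), z⟩ - ⟨B(x',v), z⟩ = ⟨B(x - x',v), z⟩` on `H¹⁰`. [cite: Tao2016AveragedNS, §1.1 (1.3)] -/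
theorem eulerForm_sub₁ {x x' v : L2C} (z : L2C) (hx : eFourierSobolevNorm 10 x < ⊤)
    (hx' : eFourierSobolevNorm 10 x' < ⊤) (hv : eFourierSobolevNorm 10 v < ⊤) :
    eulerForm x v z - eulerForm x' v z = eulerForm (x - x') v z := by
  have hxx' : eFourierSobolevNorm 10 (x - x') < ⊤ := eFourierSobolevNorm_sub_lt_top hx hx'
  have h := eulerForm_add_smul₁ 1 z hxx' hx' hv
  rw [one_smul, sub_add_cancel, one_mul] at h
  rw [h]
  ring

/-- `⟨B(u,y), z⟩ - ⟨B(u,y'), z⟩ = ⟨B(u,y - y'), z⟩` on `H¹⁰`. [cite: Tao2016AveragedNS, §1.1 (1.3)] -/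
theorem eulerForm_sub₂ {u y y' : L2C} (z : L2C) (hu : eFourierSobolevNorm 10 u < ⊤)
    (hy : eFourierSobolevNorm 10 y < ⊤) (hy' : eFourierSobolevNorm 10 y' < ⊤) :
    eulerForm u y z - eulerForm u y' z = eulerForm u (y - y') z := by
  rw [eulerForm_symm u y, eulerForm_symm u y', eulerForm_symm u (y - y')]
  exact eulerForm_sub₁ z hy hy' hu

/-- The heat propagator is a contraction of `L²`. [folklore]
[cite: Tao2016AveragedNS, §1.1 (1.3)–(1.5), (1.15) pp. 3–7 (the `H¹⁰_df` mild formulation of the true Navier–Stokes form and its Fourier-side calculus) (source of the NOTION / ARGUMENT this module implements; this declaration is the cell’s own lemma or plumbing, NOT a printed statement)] -/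
theorem norm_heat_le (τ : ℝ) (w : L2C) : ‖heat τ w‖ ≤ ‖w‖ := by
  have h := eFourierSobolevNorm_heat_le 0 τ w
  rw [Literature.Analysis.FunctionSpaces.eFourierSobolevNorm_zero_eq_enorm,
    Literature.Analysis.FunctionSpaces.eFourierSobolevNorm_zero_eq_enorm, ← ofReal_norm, ← ofReal_norm] at h
  exact (ENNReal.ofReal_le_ofReal_iff (norm_nonneg _)).1 h

/-! ### Continuity of the Duhamel integrand -/

end Literature.Analysis.PerpetualPump.PerpetualPumpEulerTypeIGlue

end Part9

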